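import Mathlib
import HarnessLib
import HarnessLib.Audit
import Summits.FinalStateConjecture.Statement
import Literature.Geometry.Lorentzian.KerrData
import Literature.Geometry.Lorentzian.WeightedNorms
import Literature.Geometry.Lorentzian.ModelData
import Literature.Geometry.Lorentzian.InitialDataPullback
import Literature.Geometry.Lorentzian.TrappedSurface
import Literature.Geometry.Lorentzian.InitialDataHomothety
import HarnessLib.Audit.Status.Attr

/-!
Route: RootDecompScaleTopology

# Route RootDecompScaleTopology — Root decomposition N1c «ScaleTopology» (form b) — HorizonLadder
leaves by signature; the horizon-free residual 27212 cut by slice TOPOLOGY and SCALE saturation as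
glued split

DECOMPOSITION CELL decomp-fsc (D-0178; doctrine D-0170/0171/0172), summit S =
`_root_.FinalStateConjecture` exactly as typed; LADDER rung 0 — NOTHING IN THIS FILE PROVES THE
FINAL STATE CONJECTURE. THIN SIBLING in FILING FORM (b) (critic standing rules 03:00:14Z /
03:45:00Z; precedents RootDecompHorizonLadder, RootDecompHoleCountCells) of
Theses/RootDecompHorizonLadder.lean (node N1b), itself the form-(b) sibling of
Theses/RootDecompKerrBasinLadder.lean (node N1): this file = node N1c «ScaleTopology». The route is
BORN with its top level BY SIGNATURE only — PerturbativeCapture = stmt-25092, NearExtremalCapture =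
25089, EnclosedCoreCapture = 25090, SmallDataDispersal = 25093 (N1's four Kerr/Minkowski model
cells), HorizonDominatedResidual = 26560, SubdominantHorizonResidual = 27211, HorizonFreeResidual =
27212 (the three horizon-graded residual cells born on N1/N1b) — and `closes` over exactly these
seven is RootDecompHorizonLadder's `closes` with its SubPenroseResidual step replaced by two
excluded middles on the horizon guards Hor d / AH d (folder/n1d/glue.lean = lens-1 g4 glue.lean,
kernel-checked rc 0 in folder/n1d/Sketch.lean, cone 7/7); the lens-1 g4 cut is then filed ON THIS
ROUTE as the GLUED SPLIT of HorizonFreeResidual (`--split HorizonFreeResidual --into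
HiddenHorizonCapture ScaledSmallDispersal GenuinelyLargeResidual --glue 'HiddenHorizonCapture →
ScaledSmallDispersal → GenuinelyLargeResidual → HorizonFreeResidual'`), because 27212 is a layer-2
item on its home route. THE MOVE: cut the horizon-free residual (one-ended admissible vacuum data in
none of N1's four model cells and with no honest outermost apparent horizon) EXACTLY by two guards
that are INVARIANT under every symmetry of the constraint map, which the born absolute-radius guards
are not — the TOPOLOGY of the Cauchy manifold (`SimplyConnectedSpace X`, Mathlib) and SCALE (the
homothety saturation Sm d :⟺ ∃ l > 0, Mink (InitialDataSet.homothety d l hl) of N1's unit H⁶₋₁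
Minkowski ball; Mink itself is NOT scale-invariant, lens kernel not_sm_homothety_iff; = caution c7
applied to δ = −1, k = 6). Pieces (exact: HorizonFreeResidual ⟺ T ∧ Λ ∧ R): T = HiddenHorizonCapture
(¬ SimplyConnectedSpace X — thin, SPECIAL-TYPE, WEAKER; dispersal and all small-data mechanisms
absent BY THEOREM: Gannon–Lee = Eichmair–Galloway–Pollack Thm 2.1, immersed MOTS present by EGP13
Thm 4.1 / Cor 3.5 though ¬AH, ℝP³-geon type; leaf IDEA-NEEDED: capture of hidden one-sided horizons
by ℤ₂-quotients of Kerr basins + topological censorship; INSTRUMENTABLE; possibly vacuous), Λ =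
ScaledSmallDispersal (Sm d — WEAKER, NOT a new mechanism, THE PARK-RULE RUNG: ATTACKABLE NOW,
DOMINATED by the born sibling SmallDataDispersal 25093 through the PDE-free homothety ports — lens
kernel scaledSmallDispersal_of_ports : AdmissibleDilationClosed (S1, in tree) → CureScaleCovariant
(S3) → TameExitDilation (S4) → SmallDataDispersal → Λ; ONE porting job serves Λ and
RootDecompCensoredShadow's BoundedRoughnessCapture 27472; norm-matched by inheritance, c4(a)), R =
GenuinelyLargeResidual (SimplyConnectedSpace X ∧ ¬ Sm d — WEAKER, NEW RESIDUAL, INTERNAL NODE,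
PARKED after this cut: horizon-free data on X ≅ ℝ³ unit-far from flat space AT EVERY SCALE = the
pure large-data formation-vs-dispersal dichotomy; IDEA-NEEDED; INSTRUMENTABLE by Φ(d) = inf_λ dist(λ
• d, trivial) on critical Brill / Teukolsky families). DOMINATION POINTER: «27212 ⟺ T ∧ Λ ∧ R;
attack Λ NOW via 25093 + ports S1/S3/S4, T by idea, PARK R; NOT 27212». The lens kernel also proves
the open glue item 27213 SubPenroseResidualGlue of N1b outright (subPenroseResidualGlue_holds) —
evidence for a prover. The whole AND/OR tree is kept in HOME/TREE.md (HOME =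
run/shared/lean/pub/decomp-fsc).
Lean: `PerturbativeCapture ∧ NearExtremalCapture ∧ EnclosedCoreCapture ∧ SmallDataDispersal ∧
HorizonDominatedResidual ∧ SubdominantHorizonResidual ∧ HorizonFreeResidual` (the seven by-signature
decls of this file; `closes` in folder/n1d/glue.lean; the lens-1 g4 pieces enter as the glued split
of HorizonFreeResidual)

## Assembly
Pure logic inside `closes` (folder/n1d/glue.lean = lens-1 g4 glue.lean = RootDecompHorizonLadder's
closes with the SubPenroseResidual step replaced by two excluded middles on Hor d / AH d; 0 sorry;
kernel-checked in folder/n1d/Sketch.lean together with the three children, the split glue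
`horizonFreeResidual_of_pieces` (two excluded middles on Sm d / SimplyConnectedSpace X), the
exactness `horizonFreeResidual_iff_pieces` and the nine-binder fallback closes₉): four model-cell
case analysis by by_cases on the window guards, then the horizon-graded residuals. Binders consumed:
all seven (cone 7 — one thesis, not two: the seven are N1's four model cells + the three
horizon-graded residual cells of ONE ladder, exactly the leaves of N1/N1b; the seventh binder exists
only because D-0019 forces the layer-2 item 27212 to the top level of a sibling before it can be
cut).

Rationale: WHY THIS LINE. A population split of the exceptional set with cure target P is free and exact
(critic `fsc_iff_cellSplit`; tame genericity is monotone and not ∧-closed, tree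
`isTameChristodoulouGeneric_and_fails`), so the content is the choice of cells: here the level sets
of DISTANCE TO THE MODEL FAMILIES in the norm the printed stability theorems use (b-conormal
weighted Sobolev tubes: Christodoulou–Klainerman 1993 for Minkowski, Klainerman–Szeftel 2023 +
Giorgi–Klainerman–Szeftel arXiv:2205.14808 for slowly rotating Kerr, Hintz 2026 claim for the full
sub-extremal range, Dafermos–Holzegel–Rodnianski–Taylor 2021 for Schwarzschild), windowed by spin
ratio and by how deep the Kerr dressing reaches (Corvino–Schoen 2006 / Kehle–Unger arXiv:2304.08455
gluing shows the shell cells are populated with arbitrary cores). Imported: weighted-Sobolev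
perturbation theory of the model solutions as a GRADING of the data space, nothing conjectural. What
it does that prior routes do not: ExactKerrEnds conditions only the END (ρ̄ = ∞, δ-free); KerrBurial
/ QuietWindowCapture / EIHFluxBalance are all-data mechanisms; lens-5's capture cells sort by the
solution's FATE — this node sorts by the DATUM's position, making the near-extremal collar
(third-law / overspinning content, Sorce–Wald arXiv:1707.05862, Kehle–Unger arXiv:2211.15742) and
the enclosed core (close-limit regime, Price–Pullin gr-qc/9402039) separately attackable and
instrumentable.

RANKED CRUXES. #2 HorizonFreeResidual (crux) — = the BORN item stmt-FinalStateConjecture-27212 of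
route-FinalStateConjecture-RootDecompHorizonLadder (node N1b, born there as layer-2 child of
SubPenroseResidual 26561), reused BY SIGNATURE (dedup-attach); INTERNAL NODE — it is a layer-2 item
on its home route (D-0019 forbids a third layer there), so HERE, immediately after birth, it
receives the critic-CLEARED lens-1 g4 cut «ScaleTopology» as its glued split on THIS route:
HiddenHorizonCapture ∧ ScaledSmallDispersal ∧ GenuinelyLargeResidual, exact by two excluded middles
on the scale guard Sm d and the topology guard SimplyConnectedSpace X (lens kernel split_iff BY NAME
vs the tree decl); text as born: [crux · gen-3 glued split of SubPenroseResidual (stmt-26561),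
lens-1 g3 node «HorizonLadder v2», CLEARED by decomp-fsc-crit-1-g0 2026-08-30T03:49:27Z; filing form
(b) · WEAKER · NEW RESIDUAL · INTERNAL NODE (gen ≥ 4) · IDEA-NEEDED — carries the trapped-surface
FORMATION mechanism (Christodoulou 0805.3880 / An–Luk / Klainerman–Luk–Rodnianski / Li–Yu
[corpus:ashtekar2015 p.588–590]) absent from its sibling; PARK RULE (critic 03:28:43Z) applies to
its next cut: it may be split again only by an attackable norm-matched rung or a thin piece with a
registered kill path, else it is parked as typed; candidate gen-4 cuts named by the lens: Schoen–Yau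
concentration scale / short-pulse cell] HORIZON-FREE RESIDUAL: for every Σ and every admissible
datum d outside the four model cells at which NO apparent horizon is present in the born sense (¬AH
d), if d fails the cure target P_Σ then a tame 1-parameter admissible line through d carries P off c
= 0 (the born exit, verbatim). One-liner = tree text of 26561 with the unused «let Hor» replaced by
«let AH»; guard «R d → ¬ AH d →». Exactness: 26561 ⟺ SubdominantHorizonResidual ∧
HorizonFreeResidual (free split by excluded middle on AH d; lens kernel
born_subPenroseResidual_iff_split vs the TREE decl, writer glue subPenroseResidual_of_pieces rc 0).
[difficulty: open-problem] (why it might fail: horizon-free large data carry the whole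
formation-vs-dispersal dichotomy: no theorem decides, for generic large AH-free vacuum data, between
trapped-surface formation and dispersion, and an open set could do neither tamely (e.g. long-lived
near-critical dynamics).) [arXiv:0805.3880, arXiv:1409.6270, arXiv:1302.5951, Christodoulou1999,
arXiv:gr-qc/9910040]
#3 SubdominantHorizonResidual (crux) — = the BORN item stmt-FinalStateConjecture-27211 of
route-FinalStateConjecture-RootDecompHorizonLadder (node N1b, layer-2 child of 26561), reused BY
SIGNATURE (dedup-attach); text as born: [crux · gen-3 glued split of SubPenroseResidual
(stmt-26561), lens-1 g3 node «HorizonLadder v2» (HOME/decomp-fsc-lens-1/g3/HorizonLadder.lean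
@8334e482), CLEARED by decomp-fsc-crit-1-g0 2026-08-30T03:49:27Z; filing form (b): split ON the thin
sibling RootDecompHorizonLadder where 26561 is top-level by signature · WEAKER (S ⟹ it; probes
P1/P3/P5 not closed) · thin · IDEA-NEEDED + INSTRUMENTABLE (census asks T-H1′/T-H2′: K4
comparable-mass Brill–Lindquist/Misner-type pairs beyond the common-MOTS fold with ratio < 0.9 live
here) · slicing-honesty caveat carried (NODE-g3.md §5(g)) · relieved BY THEOREM of the
formation/dispersal alternative (outermost MOTS + non-compact Cauchy surface ⟹ null-incomplete MGHD
[corpus:ashtekar2015 p.541])] SUBDOMINANT-HORIZON RESIDUAL: for every Σ and every admissible datum d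
outside the four model cells (perturbative / near-extremal / enclosed-core Kerr cells, Minkowski
cell — the born residual guard R d) at which an APPARENT HORIZON IS PRESENT in the born sense (AH d
:= the born «let Hor» body with its Penrose-ratio conjunct dropped: a two-sided outermost MOTS in
the born currency, floor rung p̄ = 0, kernel hor_zero_iff_apparentHorizonB) but the born
horizon-domination guard FAILS (¬Hor d: enclosure Penrose ratio < 9/10), if d fails the cure target
P_Σ then a tame 1-parameter admissible line through d carries P off c = 0 (the born exit, verbatim).
One-liner = tree text of 26561 with the born lets byte-identical plus one «let AH» inserted after …
(full text as born on the home route) [difficulty: open-problem] (why it might fail: capture given a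
certified but subdominant hole is open far from Kerr: comparable-mass two-hole data
(Brill–Lindquist/Misner beyond the common-MOTS fold) may radiate, recoil or fragment so that no tame
line through d reaches P; the born MOTS guard is slicing-sensitive (Wald–Iyer).) [arXiv:1109.2165,
arXiv:gr-qc/9910040, Christodoulou1999, arXiv:1310.4209, doi:10.1007/978-3-662-46035-1]
#4 HorizonDominatedResidual (crux) — = the BORN item stmt-FinalStateConjecture-26560 of
route-FinalStateConjecture-RootDecompKerrBasinLadder (node N1, layer-2 child of
ExtendedFieldResidual 25091; top level by signature on RootDecompHorizonLadder), reused BY SIGNATURE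
(dedup-attach); text as born: = the BORN gen-1 child stmt-FinalStateConjecture-26560 of
ExtendedFieldResidual (stmt-25091) on route-FinalStateConjecture-RootDecompKerrBasinLadder, reused
BY SIGNATURE; text as born: [crux · gen-2 glued split of ExtendedFieldResidual (stmt-25091), lens-1
g2 node HorizonSplit, CLEARED[+follow-ups F1–F3] by decomp-fsc-crit-1-g0 2026-08-30T02:58:30Z; child
A = S-exit on R ∩ 𝓗(9/10): the residual data (unit-far from every model tube of the born tuple
(6,−1,1,9/10,3,1)) whose slice carries an outermost MOTS S bounding the sole end's exterior,
WOT-free outside, m_ADM > 0 and ENCLOSURE Penrose ratio √(A_min(S)/16π) ≥ (9/10)·m_ADM;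
RESIDUAL-relieved · WEAKER (kernel horizonDominatedResidualAt_of_summit, split_iff; probes A → S / A
→ parent fail) · COUNTS-candidate → COUNTS once F1 (kernel Hor_core_iff_of_admissible on admissible
data) lands (critic 03:16:15Z: F2 inhabitant SATISFIED at print level — late slices of one-ended
collapse radiating < 19 %; F3: the p̄ = 1, k = 0 stratum is DECORATIVE-true either way and is NOT a
rung of this piece) · IDEA-NEEDED[U_rate] (caution c4 F8 topology … (full text as born on the home
route) [difficulty: open-problem] (why it might fail: Near-saturating apparent horizons do not
control the exterior in the H^s norms Kerr stability consumes (Lee–Sormani, Allen, Dong: weak norms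
only); a laminated capture threshold inside 𝓗(9/10) (comparable spectators just under the 10 %
budget) would defeat tame exits.) [arXiv:1109.2165, arXiv:1705.00591, doi:10.2140/gt.2025.29.4911,
arXiv:2304.08455, Christodoulou1999]
#5 NearExtremalCapture (crux) — = the BORN item stmt-FinalStateConjecture-25089 of
route-FinalStateConjecture-RootDecompKerrBasinLadder (node N1), reused BY SIGNATURE (dedup-attach);
text as born: = stmt on route-FinalStateConjecture-RootDecompKerrBasinLadder reused BY SIGNATURE;
PIECE rung 1a — NearExtremalCapture at (s, δ, β, χ̄, ρ̄, β₀) = (6, −1, 1, 9/10, 3, 1) [WEAKER·COUNTS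
— critic CLEARED[regime-fixed] 2026-08-30T01:33:24Z: «WEAKER·IDEA-NEEDED+BARRIER (counts)»; leaf
IDEA-NEEDED + BARRIER (AretakisInstability prices any uniform-ε approach) + INSTRUMENTABLE
(near-extremal QNM damping ∝ √(1−χ), degeneration rate of ε(χ))]. For every Σ and every admissible
P_Σ-exceptional datum d lying in the near-extremal Kerr window cell — granted the vendored Kerr
facts, some sub-extremal Kerr data (M, a, r₀) with 9/10 < |a|/M < 1 and horizon-penetrating depth 1
− √(1−χ²) < r₀/M < 1 + √(1−χ²), and a smooth cocompact open embedding θ of the Kerr slice into Σ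
along which θ^*d is b-conormal (finite H^s'_(−1) distance at every order) and 1-close at order 6 to
the Kerr data — there are one end e and a tame immersed injective one-parameter family F of
admissible data with F 0 = d whose members c ≠ 0 satisfy P_Σ. [difficulty: open-problem] (why it
might fail: no printed basin is uniform as χ → 1 and the extremal limit carries the Aretakis /
zero-damped-mode instability; a near-extremal datum could overspin or hover at extremality along
every tame curve through it.) [arXiv:1707.05862, arXiv:2211.15742, arXiv:1910.02854, Hintz2026,
arXiv:1206.6598]
#6 EnclosedCoreCapture (crux) — = the BORN item stmt-FinalStateConjecture-25090 of
route-FinalStateConjecture-RootDecompKerrBasinLadder (node N1), reused BY SIGNATURE (dedup-attach);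
text as born: = stmt on route-FinalStateConjecture-RootDecompKerrBasinLadder reused BY SIGNATURE;
PIECE rung 1b — EnclosedCoreCapture at (s, δ, β, χ̄, ρ̄, β₀) = (6, −1, 1, 9/10, 3, 1) [WEAKER·COUNTS
— critic: «WEAKER·IDEA-NEEDED·INSTRUMENTABLE (counts; COSTUME only as ρ̄ → ∞)»; leaf INSTRUMENTABLE
(close-limit / NR at ρ̄ = 3) + IDEA-NEEDED (large-data mechanism confined to a compact core:
trapped-surface formation inside the hoop, then rung 0)]. For every Σ and every admissible
P_Σ-exceptional datum d lying in the enclosed-core shell cell — sub-extremal Kerr dressing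
(b-conormal, 1-close at order 6, weight −1) along a cocompact embedded Kerr slice that reaches only
down to a sphere r₀ = ρM with 1 + √(1−χ²) ≤ ρ ≤ 3 (on or outside the horizon radius; the core inside
is arbitrary) — there are one end e and a tame immersed injective admissible one-parameter family F
with F 0 = d whose members c ≠ 0 satisfy P_Σ. [difficulty: open-problem] (why it might fail: a
strong-field core inside r ≤ 3M (near-critical packet inside its own hoop, pre-merger binary) may
form a naked singularity or a non-settling exterior robustly along tame curves — no theorem controls
any core below the dressing sphere.) [arXiv:2304.08455, arXiv:gr-qc/9402039, arXiv:0805.3880,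
CorvinoSchoen2006]
#7 PerturbativeCapture (crux) — = the BORN item stmt-FinalStateConjecture-25092 of
route-FinalStateConjecture-RootDecompKerrBasinLadder (node N1), reused BY SIGNATURE (dedup-attach);
text as born: = stmt on route-FinalStateConjecture-RootDecompKerrBasinLadder reused BY SIGNATURE;
PIECE rung 0→1 — PerturbativeCapture at (s, δ, β, χ̄, ρ̄, β₀) = (6, −1, 1, 9/10, 3, 1) [WEAKER;
critic: «DECORATIVE-by-claim (β → 0⁺) / UNDECIDED[effective ε], ATTACKABLE (porting) — NOT COUNTED»;
at the typed β = 1 OPEN only by effectivity of the printed ε(M, χ) and scale non-covariance (lens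
H2); leaf ATTACKABLE (porting `klainerman_szeftel_kerr_stability_small_a_cauchy`,
`hintz_kerr_stability_subextremal_cauchy` through the lens's `onCell_of_forall_settles`) +
IDEA-NEEDED (effective basin radius)]. For every Σ and every admissible P_Σ-exceptional datum d in
the perturbative Kerr window cell (spin ratio ≤ 9/10, horizon-penetrating depth, b-conormal and
1-close at order 6, weight −1, to sub-extremal Kerr data along a cocompact embedded Kerr slice),
there are one end e and a tame immersed injective admissible one-parameter family F with F 0 = d
whose members c ≠ 0 satisfy P_Σ. [difficulty: open-problem] (why it might fail: β = 1 is an absolute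
radius while every printed basin ε(M, χ) is inexplicit and non-uniform; data 1-close to a small-mass
Kerr anchor are relatively large perturbations and may collapse further or radiate away the hole.)
[KlainermanSzeftel2023, arXiv:2205.14808, Hintz2026, arXiv:2104.08222]
#8 SmallDataDispersal (crux) — = the BORN item stmt-FinalStateConjecture-25093 of
route-FinalStateConjecture-RootDecompKerrBasinLadder (node N1), reused BY SIGNATURE (dedup-attach);
text as born: = stmt on route-FinalStateConjecture-RootDecompKerrBasinLadder reused BY SIGNATURE;
PIECE rung 0′ — SmallDataDispersal at (s, δ, β, χ̄, ρ̄, β₀) = (6, −1, 1, 9/10, 3, 1) [WEAKER;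
critic: «same (CK93) — NOT COUNTED»; DECORATIVE in the limit β₀ → 0⁺ by
`christodoulou_klainerman_stability_minkowski_cauchy`; at β₀ = 1 open by effectivity only; leaf
ATTACKABLE (porting of gr.S07-cauchy) + effective part IDEA-NEEDED]. For every Σ and every
admissible P_Σ-exceptional datum d in the Minkowski cell (Σ globally a copy of ℝ³ via a surjective
smooth open embedding θ of the Minkowski slice, θ^*d b-conormal and 1-close at order 6, weight −1,
to the trivial data), there are one end e and a tame immersed injective admissible one-parameter
family F with F 0 = d whose members c ≠ 0 satisfy P_Σ. [difficulty: open-problem] (why it might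
fail: no explicit Christodoulou–Klainerman radius is in print; β₀ = 1 in H^6_(−1) may exceed the
true dispersive basin, letting some cell data collapse to a black hole whose settling is then the
full problem.) [ChristodoulouKlainerman1993, arXiv:2108.13379, LindbladRodnianski2010, Bieri2009]

TWO-LAYER PLAN. Layer 2 here = {HiddenHorizonCapture, ScaledSmallDispersal, GenuinelyLargeResidual}
under HorizonFreeResidual (filed as the glued split right after birth; glue item provable now by the
lens proof `glue` / `Items.glue_items`, folder proof `horizonFreeResidual_of_pieces`). Foreseen, NOT
filed: beneath Λ the PDE-free ports S3 CureScaleCovariant / S4 TameExitDilation (S1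
AdmissibleDilationClosed in tree) — the SAME porting job as RootDecompCensoredShadow's 27472,
attached by a prover with --supports, never as items (D-0019 two layers); beneath T the idea-leaf
«ℤ₂-quotient capture» (no typed rung); beneath R nothing — PARKED (lens-1 NODE-g4 §6: after topology
× scale no symmetry-invariant, PDE-free, norm-matched predicate is left in the tree to carve R by;
the ladder lens is EXHAUSTED on 27212, V1–V6 recorded).

KILL CRITERIA. All seven binders and all three split children are S-implied in the lens kernel
(children_of_summit, *_of_summit), so a refutation of any of them — a tame-open set of exceptional
data inside one cell: horizon-free data on a non-simply-connected slice with a tame-stable non-Kerr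
end state (T), a homothetic copy of Minkowski-cell data that fails P while 25093 holds (Λ — would
contradict the dilation covariance of the vacuum Cauchy problem, i.e. expose a typing defect of P or
of admissibility under homothety: S1 is landed, so the defect would sit in S3/S4), scale-far
horizon-free data on ℝ³ with a tame-stable naked singularity or eternal hair (R) — refutes the
summit AS TYPED and closes this route `refuted:<Decl>`; it feeds the statement audit, not a pivot.
Mooted piecewise: Λ closes when S3/S4 are ported (then Λ ⟸ 25093); T may close as VACUOUS if every
admissible horizon-free datum on such X already satisfies P; all three are mooted by a direct proof
of 27212 on HorizonLadder or of 26561 / 25091 upstream. Superseded if the critic retires this cut of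
27212 in favour of another.

NOT DECOMPOSED YET. GenuinelyLargeResidual's interior (the large-data formation-vs-dispersal
dichotomy on ℝ³: Christodoulou arXiv:0805.3880, Klainerman–Luk–Rodnianski arXiv:1302.5951, An–Luk,
Li–Yu formation for DESIGNED data only; dispersal only perturbative, Christodoulou–Klainerman 1993 /
arXiv:math/0411109 / arXiv:0904.0620; critical collapse doi:10.1103/PhysRevLett.70.2980) is
famous-grade and deliberately not decomposed (PARKED); the scale layers of the three Kerr WINDOW
cells (K W is not homothety-saturated either) stay distributed over 26560 / 27211 / R by the horizon
guards — saturating K W is a recorded gen-5 option on 26560/27211, not this node; constants never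
enter binders.

CHEAPEST FALSIFIER. ScaledSmallDispersal: port S3 CureScaleCovariant + S4 TameExitDilation (PDE-free
bookkeeping over CauchyDevelopmentConstSmul / NullInfinityConstSmul / LateChartDilation /
InitialDataHomothety) — if either fails to type-check against the Statement's P (e.g. a clause of P
not dilation-covariant as typed) Λ dies as typed and the finding goes to the statement audit;
expected to go through (lens-6 g4 and lens-1 g4 kernels agree on the port texts).
HiddenHorizonCapture: exhibit ONE admissible one-ended vacuum datum on a non-simply-connected X in
the tree's admissible class (ℝP³-geon t = 0 slice, EGP13 p.6) and check P on it — if P fails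
tame-stably there, T (and S) die. GenuinelyLargeResidual: an NR catalogue entry of scale-far
horizon-free vacuum data (near-critical Brill waves, arXiv:1008.3319, arXiv:2205.04379) with a naked
end state on an OPEN set (none known). The route itself dies cheaply if the by-signature attach of
any of its seven items is refused (fallback (a): flat cone with T, Λ, R as new items + six by
signature, closes₉ in folder/n1d/Sketch.lean).

NUMBERS. Fixed tuple (s, δ, β, χ̄, ρ̄, β₀) = (6, −1, 1, 9/10, 3, 1): s = 6 (order of closeness), δ =
−1 (b-weight, CK range (−3/2, −1/2)), β = β₀ = 1 (absolute tube radii in `dataWeightedSobolevEDist 6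
(−1)`), χ̄ = 9/10 (collar starts at spin ratio 0.9; NR remnant spins ≤ 0.95 on open sets,
arXiv:1904.04831), ρ̄ = 3 (dressing sphere at most at 3M, the Schwarzschild photon sphere;
close-limit regime gr-qc/9402039). Printed basins: ε(M, χ) inexplicit (KS 2023 Thm 1.2.1; Hintz 2026
Thm 13.1), CK93 ε inexplicit.

DEFINITION REQUESTS. None new. S3/S4 ports are typed as Props in the lens kernels
(decomp-fsc-lens-1/g4/ScaleTopology.lean, decomp-fsc-lens-6/g4) over existing declarations
(InitialDataHomothety etc.); the cell's pending requests D1–D4 (defn-ConeSeedData,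
wi-96534/96535/96536, defn-InitialDataSet.charWeightedEDist) concern other branches.

Novelty: GEN-4 on 27212 (2026-08-30T04:54:57Z, lens-1 g4 + writer): the move = cut a born residual cell by
the TOPOLOGY of the Cauchy manifold and by the SCALING GROUP of the constraint equations (homothety
saturation of an absolute-radius cell), both invariant under the symmetries the born guards break;
the only node in the tree with a topological guard; the scale half is caution c7 applied to a
different born cell than lens-6 g4's ScaleCarve (N1 Minkowski ball δ = −1, k = 6 vs N5c censored
shadow δ = 1, k = 2), ports shared. Searches (lens-1, 2026-08-30, NODE-g4.md §10, labelled): `lit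
search "Gannon singularities nonsimply connected space-times" --source all` →
[corpus:paper:arxiv-2005.02918 p.9], [corpus:paper:arxiv-1207.1113 p.11],
[graph:doi:10.1063/1.522498]; `lit search "Friedman Schleich Witt topological censorship"` →
[corpus:paper:arxiv-1204.0278 p.3–4], [corpus:paper:arxiv-1906.02151 p.2,9],
[corpus:paper:arxiv-1403.0988 p.9]; `lit search "geon projective plane minimal surface" --source
local` → [corpus:paper:arxiv-1204.0278 p.6], [corpus:book:ashtekar2015 p.550]; `lit galaxy search
"RP3 geon|RP^3 geon|geon black hole" --star all` → no relevant hits; `lit galaxy search "topological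
censorship|Gannon-Lee|nonsimply connected space-times" --star pdf` → 8 off-topic rows ⇒ null for a
stability / settling theorem on π₁ ≠ 1 slices in galaxy; `lit vsearch "nonlinear stability of the
RP3 geon or of a quotient of Kerr by a discrete isometry…" -k 8` → textbooks only ⇒ null in corpus(  [refs: 10.1063/1.522498, 10.1103/PhysRevLett.70.2980., 1204.0278, gr-qc/9305017, 2304.08455, paper:arxiv-2005.02918, paper:arxiv-1207.1113, doi:10.1063/1.522498, paper:arxiv-1204.0278, paper:arxiv-1906.02151, paper:arxiv-1403.0988, book:ashtekar2015, paper:arxiv-1008.3319, paper:arxiv-2205.04379, paper:arxiv-2111.04752, doi:10.1103/PhysRevLett.70.2980., arxiv-2302.06636, arxiv-2205.14808, arxiv-2402.1019]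

Barriers (technique_class: population-split, topology-guard, scale-saturation): - technique_class: population-split, topology-guard, scale-saturation
- Literature.Barriers.FinalStateConjecture.AretakisInstability: bites NearExtremalCapture head-on
(no uniform-in-spin control up to |a| = M; transversal-derivative growth on extremal horizons) —
declared as that piece's BARRIER tag, not evaded; the bet is a dynamical third-law / no-overspinning
mechanism for perturbations large relative to the shrinking basin; the other four pieces stay at
spin ≤ 9/10 or away from horizons.
- Literature.Barriers.FinalStateConjecture.AretakisInstabilityNarrow: same placement for the collar
cell; recorded.
- Literature.Barriers.FinalStateConjecture.SlowlyRotatingKerrFrontier: PerturbativeCapture at χ̄ =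
9/10 lies beyond the refereed slowly-rotating range (KS 2023) and leans on the unrefereed full-range
claim (Hintz 2026) for its germ — acknowledged; the piece is not counted as content.
- Literature.Barriers.FinalStateConjecture.KerrStabilityHoldsBelowNarrow: the printed small-|a|
stability does NOT empty the perturbative cell at the typed β = 1 (ε inexplicit, absolute units) —
so PerturbativeCapture is not a restated theorem (critic T3), and it is tagged
decorative-in-the-limit, not counted.
- Literature.Barriers.FinalStateConjecture.KerrSuperradiance: decay-estimate barrier for the linear
roads under the capture pieces; binders are data-side cure statements — outside; porting roads meet
it as the printed proofs do.
- Literature.Barriers.FinalStateConjecture.SbierskiTrappingO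

sub-problem: FinalStateConjecture · status: draft · opened planner-decomp-fsc-writer-1-g0-0 2026-08-30T05:03:55Z · rev 1 · ledger route-FinalStateConjecture-RootDecompScaleTopology
GENERATED by the gate from the ledger (D-0016/17). Provers cite these decls: `theorem foo : Summit.FinalStateConjecture.FinalStateConjecture.Theses.RootDecompScaleTopology.<Decl> := …` in Summits/FinalStateConjecture/FinalStateConjecture/Theorems/<Name>.lean.
-/

namespace Summit.FinalStateConjecture.FinalStateConjecture.Theses.RootDecompScaleTopology

open scoped BigOperators Topology Manifold Classical MeasureTheory ProbabilityTheory Matrix InnerProductSpace ComplexConjugate ContinuousMap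
open Filter Set Function TopologicalSpace MeasureTheory

attribute [summit_statement] _root_.FinalStateConjecture

/-- item stmt-FinalStateConjecture-27212 · crux · rank 2 · SPLIT (gen 1) into GenuinelyLargeResidual, HiddenHorizonCapture, ScaledSmallDispersal + glue HorizonFreeResidualGlue · direct attempts still welcome (low priority) · by planner
why it might fail: horizon-free large data carry the whole formation-vs-dispersal dichotomy: no theorem decides, for generic large AH-free vacuum data, between trapped-surface formation and dispersion, and an open set could do neither tamely (e.g. long-lived near-critical dynamics).
sources: arXiv:0805.3880, arXiv:1409.6270, arXiv:1302.5951, Christodoulou1999, arXiv:gr-qc/9910040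
[crux · gen-3 glued split of SubPenroseResidual (stmt-26561), lens-1 g3 node «HorizonLadder v2»,
CLEARED by decomp-fsc-crit-1-g0 2026-08-30T03:49:27Z; filing form (b) · WEAKER · NEW RESIDUAL ·
INTERNAL NODE (gen ≥ 4) · IDEA-NEEDED — carries the trapped-surface FORMATION mechanism
(Christodoulou 0805.3880 / An–Luk / Klainerman–Luk–Rodnianski / Li–Yu [corpus:ashtekar2015
p.588–590]) absent from its sibling; PARK RULE (critic 03:28:43Z) applies to its next cut: it may be
split again only by an attackable norm-matched rung or a thin piece with a registered kill path,
else it is parked as typed; candidate gen-4 cuts named by the lens: Schoen–Yau concentration scale /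
short-pulse cell] HORIZON-FREE RESIDUAL: for every Σ and every admissible datum d outside the four
model cells at which NO apparent horizon is present in the born sense (¬AH d), if d fails the cure
target P_Σ then a tame 1-parameter admissible line through d carries P off c = 0 (the born exit,
verbatim). One-liner = tree text of 26561 with the unused «let Hor» replaced by «let AH»; guard «R d
→ ¬ AH d →». Exactness: 26561 ⟺ SubdominantHorizonResidual ∧ HorizonFreeResidual (free split by
excluded middle on AH d; lens kernel -/
@[route_item "route-FinalStateConjecture-RootDecompScaleTopology", crux]
def HorizonFreeResidual : Prop :=
  ∀ (X : Type) [TopologicalSpace X] [ChartedSpace Literature.Geometry.Lorentzian.E3 X] [IsManifold (𝓡 3) ((⊤ : ℕ∞) : WithTop ℕ∞) X] [T2Space X] [SecondCountableTopology X] [ConnectedSpace X], let P : Literature.Geometry.Lorentzian.InitialDataSet (𝓡 3) X → Prop := fun D ↦ (∃ 𝒟 : Literature.Geometry.Lorentzian.VacuumCauchyDevelopment D, 𝒟.IsMaximal) ∧ ∀ 𝒟 : Literature.Geometry.Lorentzian.VacuumCauchyDevelopment D, 𝒟.IsMaximal → Summit.FinalStateConjecture.HasCompleteNullInfinity 𝒟.toCauchyDevelopment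 ∧ ∃ (O : Set 𝒟.carrier) (d : Literature.Geometry.Lorentzian.FinalStateDecomposition 𝒟.toSpacetime O 2), (∀ i, Literature.Geometry.Lorentzian.Kerr.IsSubextremal (d.mass i) (d.spin i)) ∧ O = Summit.FinalStateConjecture.exteriorOf 𝒟.toCauchyDevelopment d.charted ∧ Summit.FinalStateConjecture.RaysStayInClosure 𝒟.toCauchyDevelopment O ∧ Summit.FinalStateConjecture.HasExhaustiveCharts d ∧ Summit.FinalStateConjecture.IsFutureOriented d; let K : Set (ℝ × ℝ) → Literature.Geometry.Lorentzian.InitialDataSet (𝓡 3) X → Prop := fun W D ↦ ∀ [Literature.Geometry.Lorentzian.Kerr.Facts] [Literature.Geometry.Lorentzian.Kerr.SliceFacts], ∃ (M a r₀ : ℝ) (hM : 0 < M), |a| < M ∧ (|a| / M, r₀ / M) ∈ W ∧ ∃ (θ : Literature.Geometry.Lorentzian.Kerr.slice a r₀ → X) (hθ : ContMDiff 𝓘(ℝ, Literature.Geometry.Lorentzian.E3) (𝓡 3) (((⊤ : ℕ∞) : WithTop ℕ∞) + 1) θ) (hθ' : ∀ u, Injective (mfderiv 𝓘(ℝ, Literature.Geometry.Lorentzian.E3)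 (𝓡 3) θ u)), Topology.IsOpenEmbedding θ ∧ IsCompact (range θ)ᶜ ∧ (∀ s' : ℕ, Literature.Geometry.Lorentzian.InitialDataSet.dataWeightedSobolevEDist s' (-1 : ℝ) (D.comap θ hθ hθ') (Literature.Geometry.Lorentzian.Kerr.data M a r₀ hM.le) < ⊤) ∧ Literature.Geometry.Lorentzian.InitialDataSet.dataWeightedSobolevEDist 6 (-1 : ℝ) (D.comap θ hθ hθ') (Literature.Geometry.Lorentzian.Kerr.data M a r₀ hM.le) < ENNReal.ofReal 1; let Mink : Literature.Geometry.Lorentzian.InitialDataSet (𝓡 3) X → Prop := fun D ↦ ∃ (θ : Literature.Geometry.Lorentzian.Minkowski.slice → X) (hθ : ContMDiff 𝓘(ℝ, Literature.Geometry.Lorentzian.E3) (𝓡 3) (((⊤ : ℕ∞) : WithTop ℕ∞) + 1) θ) (hθ' : ∀ u, Injective (mfderiv 𝓘(ℝ, Literature.Geometry.Lorentzian.E3) (𝓡 3) θ u)), Topology.IsOpenEmbedding θ ∧ Surjective θ ∧ (∀ s' : ℕ, Literature.Geometry.Lorentzian.InitialDataSet.dataWeightedSobolevEDist s' (-1 :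 ℝ) (D.comap θ hθ hθ') Literature.Geometry.Lorentzian.trivialData < ⊤) ∧ Literature.Geometry.Lorentzian.InitialDataSet.dataWeightedSobolevEDist 6 (-1 : ℝ) (D.comap θ hθ hθ') Literature.Geometry.Lorentzian.trivialData < ENNReal.ofReal 1; let pert : Set (ℝ × ℝ) := {p | p.1 ≤ (9 / 10 : ℝ) ∧ 1 - Real.sqrt (1 - p.1 ^ 2) < p.2 ∧ p.2 < 1 + Real.sqrt (1 - p.1 ^ 2)}; let collar : Set (ℝ × ℝ) := {p | (9 / 10 : ℝ) < p.1 ∧ 1 - Real.sqrt (1 - p.1 ^ 2) < p.2 ∧ p.2 < 1 + Real.sqrt (1 - p.1 ^ 2)}; let shell : Set (ℝ × ℝ) := {p | 1 + Real.sqrt (1 - p.1 ^ 2) ≤ p.2 ∧ p.2 ≤ 3}; let AH : Literature.Geometry.Lorentzian.InitialDataSet (𝓡 3) X → Prop := fun D ↦ ∃ (hLC : D.metric.HasLeviCivita) (e : Literature.Geometry.Lorentzian.AFEnd X) (S : Literature.Geometry.Lorentzian.OutermostMOTS (𝓡 3) D.h D.k), haveI : (Literature.Geometry.Lorentzian.PseudoRiemannianMetric.ofRiemannian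 D.h).HasLeviCivita := hLC; let IsExteriorRegion : TopologicalSpace.Opens X → Prop := fun U ↦ IsConnected (U : Set X) ∧ ∃ R', e.R < R' ∧ e.far R' ⊆ (U : Set X) ∧ IsCompact (closure (U : Set X) \ e.far R'); let IsOutsideOf : TopologicalSpace.Opens X → (S' : Type) → (f' : S' → X) → Literature.Geometry.Lorentzian.NormalField (𝓡 3) f' → Prop := fun U _ f' ν' ↦ frontier (U : Set X) = Set.range f' ∧ (∀ y, ∀ᶠ t in nhdsWithin (0 : ℝ) (Set.Ioi 0), Literature.Geometry.Lorentzian.curveThrough (𝓡 3) (f' y) (ν' y) t ∈ (U : Set X)) ∧ (∀ y, ∀ᶠ t in nhdsWithin (0 : ℝ) (Set.Iio 0), Literature.Geometry.Lorentzian.curveThrough (𝓡 3) (f' y) (ν' y) t ∉ closure (U : Set X)) ∧ IsExteriorRegion U; let WOTFree : TopologicalSpace.Opens X → Prop := fun U ↦ ∀ (S' : Type) [TopologicalSpace S'] [ChartedSpace (EuclideanSpace ℝ (Fin 2)) S'] [IsManifold (𝓡 2) ((⊤ : ℕ∞) : WithTop ℕ∞) S'] [CompactSpace S'] [T2Space S']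 (f' : S' → X) (ν' : Literature.Geometry.Lorentzian.NormalField (𝓡 3) f') (hpb' : Literature.Geometry.Lorentzian.PseudoRiemannianMetric.contMDiff_pullbackBilin (𝓡 3) X (𝓡 2) S' ((⊤ : ℕ∞) : WithTop ℕ∞)) (hf' : (Literature.Geometry.Lorentzian.PseudoRiemannianMetric.ofRiemannian D.h).IsSpacelikeImmersion (𝓡 2) f') (Ω : TopologicalSpace.Opens X), Manifold.IsSmoothEmbedding (𝓡 2) (𝓡 3) ((⊤ : ℕ∞) : WithTop ℕ∞) f' → Set.range f' ⊆ (U : Set X) → (Literature.Geometry.Lorentzian.PseudoRiemannianMetric.ofRiemannian D.h).IsUnitNormal (𝓡 2) f' ν' 1 → Nonempty S' → frontier (Ω : Set X) = Set.range f' → (∃ R', e.R < R' ∧ Disjoint (e.far R') (Ω : Set X)) → (∀ y, ∀ᶠ t in nhdsWithin (0 : ℝ) (Set.Iio 0), Literature.Geometry.Lorentzian.curveThrough (𝓡 3) (f' y) (ν' y) t ∈ (Ω : Set X)) → ¬ Literature.Geometry.Lorentzian.IsWeaklyOuterTrapped D.h D.k f' hpb' hf' ν'; ContMDiff (𝓡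 2) (𝓡 3).tangent ((⊤ : ℕ∞) : WithTop ℕ∞) (fun y ↦ (Bundle.TotalSpace.mk' Literature.Geometry.Lorentzian.E3 (S.f y) (S.ν y) : TangentBundle (𝓡 3) X)) ∧ D.SatisfiesDominantEnergyCondition ∧ e.IsAsymptoticallyFlat D 1 ∧ D.IsComplete ∧ (∃ m, e.HasADMEnergy D m) ∧ (∀ i, ∃ p, e.HasADMMomentum D i p) ∧ WOTFree S.exterior ∧ IsOutsideOf S.exterior S.surf S.f S.ν ∧ 0 < e.admMass D; ∀ d ∈ Literature.Geometry.Lorentzian.admissibleVacuumData X, ¬ P d → (¬ K pert d ∧ ¬ K collar d ∧ ¬ K shell d ∧ ¬ Mink d) → ¬ AH d → ∃ (e : Literature.Geometry.Lorentzian.AFEnd X) (F : EuclideanSpace ℝ (Fin 1) → Literature.Geometry.Lorentzian.InitialDataSet (𝓡 3) X), Literature.Geometry.Lorentzian.InitialDataSet.IsTameDataFamily e 1 F ∧ Literature.Geometry.Lorentzian.InitialDataSet.IsImmersedAtZero 1 F ∧ F 0 = d ∧ Injective F ∧ (∀ c, F c ∈ Literature.Geometry.Lorentzian.admissibleVacuumData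 X) ∧ ∀ c ≠ 0, P (F c)

-- parent: HorizonFreeResidual · child (gen 1)
/--     item stmt-FinalStateConjecture-28337 · crux · rank 201 · open
    parent: HorizonFreeResidual · by planner
    why it might fail: weak cosmic censorship + Kerr final state for genuinely large horizon-free vacuum data on ℝ³: threshold (critical-collapse) data of Brill/Teukolsky-wave families and eternal non-settling large solutions are excluded by no theorem; P-genericity along ONE tame line may fail at threshold data
    sources: arXiv:0805.3880, AnLuk2017, LiYu2015, arXiv:1302.5951, ChristodoulouKlainerman1993, Klainerman2025
[crux · gen-4 cut of HorizonFreeResidual (stmt-FinalStateConjecture-27212), lens-1 g4 node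
ScaleTopology · NEW RESIDUAL · INTERNAL NODE — recommend PARK after this cut (critic park rule
03:28:43Z: no norm-matched rung remains to carve short of a large-data formation-vs-dispersal
theorem) · WEAKER (lens kernel genuinelyLargeResidual_of_summit, split_iff; ⇏ parent: silent on
slices with π₁ ≠ 1 and on blow-ups of small data) · carries TWO usable hypotheses the parent lacks:
X SIMPLY CONNECTED (hence ≅ ℝ³ for one-ended AF data — EichmairGallowayPollack2013 Thm 4.1, proof
p.9, via Poincaré) and d UNIT-FAR FROM TRIVIAL DATA AT EVERY SCALE (the scale-saturated Minkowski
test fails for every homothetic copy (l²h, lk): scale-invariant largeness, kernel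
not_sm_homothety_iff / residual_core_homothety) · leaf IDEA-NEEDED (the large-data dichotomy on ℝ³:
horizon-free, window-far, scale-far vacuum data must GENERICALLY form sub-extremal Kerr black holes
or disperse — Christodoulou 2009 / An–Luk / Li–Yu / Klainerman–Luk–Rodnianski give formation for
designed data only, CK93 dispersal only perturbatively) · INSTRUMENTABLE (Φ(d) = inf_λ
dist_{H⁶₋₁}(λ·d, trivial) on near-critical Brill / Teukolsky-w -/
@[route_item "route-FinalStateConjecture-RootDecompScaleTopology"]
def GenuinelyLargeResidual : Prop :=
  ∀ (X : Type) [TopologicalSpace X] [ChartedSpace Literature.Geometry.Lorentzian.E3 X] [IsManifold (𝓡 3) ((⊤ : ℕ∞) : WithTop ℕ∞) X] [T2Space X] [SecondCountableTopology X] [ConnectedSpace X], let P : Literature.Geometry.Lorentzian.InitialDataSet (𝓡 3) X → Prop := fun D ↦ (∃ 𝒟 : Literature.Geometry.Lorentzian.VacuumCauchyDevelopment D, 𝒟.IsMaximal) ∧ ∀ 𝒟 : Literature.Geometry.Lorentzian.VacuumCauchyDevelopment D, 𝒟.IsMaximal → Summit.FinalStateConjecture.HasCompleteNullInfinity 𝒟.toCauchyDevelopment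 ∧ ∃ (O : Set 𝒟.carrier) (d : Literature.Geometry.Lorentzian.FinalStateDecomposition 𝒟.toSpacetime O 2), (∀ i, Literature.Geometry.Lorentzian.Kerr.IsSubextremal (d.mass i) (d.spin i)) ∧ O = Summit.FinalStateConjecture.exteriorOf 𝒟.toCauchyDevelopment d.charted ∧ Summit.FinalStateConjecture.RaysStayInClosure 𝒟.toCauchyDevelopment O ∧ Summit.FinalStateConjecture.HasExhaustiveCharts d ∧ Summit.FinalStateConjecture.IsFutureOriented d; let K : Set (ℝ × ℝ) → Literature.Geometry.Lorentzian.InitialDataSet (𝓡 3) X → Prop := fun W D ↦ ∀ [Literature.Geometry.Lorentzian.Kerr.Facts] [Literature.Geometry.Lorentzian.Kerr.SliceFacts], ∃ (M a r₀ : ℝ) (hM : 0 < M), |a| < M ∧ (|a| / M, r₀ / M) ∈ W ∧ ∃ (θ : Literature.Geometry.Lorentzian.Kerr.slice a r₀ → X) (hθ : ContMDiff 𝓘(ℝ, Literature.Geometry.Lorentzian.E3) (𝓡 3) (((⊤ : ℕ∞) : WithTop ℕ∞) + 1) θ) (hθ' : ∀ u, Injective (mfderiv 𝓘(ℝ, Literature.Geometry.Lorentzian.E3)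 (𝓡 3) θ u)), Topology.IsOpenEmbedding θ ∧ IsCompact (range θ)ᶜ ∧ (∀ s' : ℕ, Literature.Geometry.Lorentzian.InitialDataSet.dataWeightedSobolevEDist s' (-1 : ℝ) (D.comap θ hθ hθ') (Literature.Geometry.Lorentzian.Kerr.data M a r₀ hM.le) < ⊤) ∧ Literature.Geometry.Lorentzian.InitialDataSet.dataWeightedSobolevEDist 6 (-1 : ℝ) (D.comap θ hθ hθ') (Literature.Geometry.Lorentzian.Kerr.data M a r₀ hM.le) < ENNReal.ofReal 1; let Mink : Literature.Geometry.Lorentzian.InitialDataSet (𝓡 3) X → Prop := fun D ↦ ∃ (θ : Literature.Geometry.Lorentzian.Minkowski.slice → X) (hθ : ContMDiff 𝓘(ℝ, Literature.Geometry.Lorentzian.E3) (𝓡 3) (((⊤ : ℕ∞) : WithTop ℕ∞) + 1) θ) (hθ' : ∀ u, Injective (mfderiv 𝓘(ℝ, Literature.Geometry.Lorentzian.E3) (𝓡 3) θ u)), Topology.IsOpenEmbedding θ ∧ Surjective θ ∧ (∀ s' : ℕ, Literature.Geometry.Lorentzian.InitialDataSet.dataWeightedSobolevEDist s' (-1 :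 ℝ) (D.comap θ hθ hθ') Literature.Geometry.Lorentzian.trivialData < ⊤) ∧ Literature.Geometry.Lorentzian.InitialDataSet.dataWeightedSobolevEDist 6 (-1 : ℝ) (D.comap θ hθ hθ') Literature.Geometry.Lorentzian.trivialData < ENNReal.ofReal 1; let pert : Set (ℝ × ℝ) := {p | p.1 ≤ (9 / 10 : ℝ) ∧ 1 - Real.sqrt (1 - p.1 ^ 2) < p.2 ∧ p.2 < 1 + Real.sqrt (1 - p.1 ^ 2)}; let collar : Set (ℝ × ℝ) := {p | (9 / 10 : ℝ) < p.1 ∧ 1 - Real.sqrt (1 - p.1 ^ 2) < p.2 ∧ p.2 < 1 + Real.sqrt (1 - p.1 ^ 2)}; let shell : Set (ℝ × ℝ) := {p | 1 + Real.sqrt (1 - p.1 ^ 2) ≤ p.2 ∧ p.2 ≤ 3}; let AH : Literature.Geometry.Lorentzian.InitialDataSet (𝓡 3) X → Prop := fun D ↦ ∃ (hLC : D.metric.HasLeviCivita) (e : Literature.Geometry.Lorentzian.AFEnd X) (S : Literature.Geometry.Lorentzian.OutermostMOTS (𝓡 3) D.h D.k), haveI : (Literature.Geometry.Lorentzian.PseudoRiemannianMetric.ofRiemannian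 D.h).HasLeviCivita := hLC; let IsExteriorRegion : TopologicalSpace.Opens X → Prop := fun U ↦ IsConnected (U : Set X) ∧ ∃ R', e.R < R' ∧ e.far R' ⊆ (U : Set X) ∧ IsCompact (closure (U : Set X) \ e.far R'); let IsOutsideOf : TopologicalSpace.Opens X → (S' : Type) → (f' : S' → X) → Literature.Geometry.Lorentzian.NormalField (𝓡 3) f' → Prop := fun U _ f' ν' ↦ frontier (U : Set X) = Set.range f' ∧ (∀ y, ∀ᶠ t in nhdsWithin (0 : ℝ) (Set.Ioi 0), Literature.Geometry.Lorentzian.curveThrough (𝓡 3) (f' y) (ν' y) t ∈ (U : Set X)) ∧ (∀ y, ∀ᶠ t in nhdsWithin (0 : ℝ) (Set.Iio 0), Literature.Geometry.Lorentzian.curveThrough (𝓡 3) (f' y) (ν' y) t ∉ closure (U : Set X)) ∧ IsExteriorRegion U; let WOTFree : TopologicalSpace.Opens X → Prop := fun U ↦ ∀ (S' : Type) [TopologicalSpace S'] [ChartedSpace (EuclideanSpace ℝ (Fin 2)) S'] [IsManifold (𝓡 2) ((⊤ : ℕ∞) : WithTop ℕ∞) S'] [CompactSpace S'] [T2Space S']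 (f' : S' → X) (ν' : Literature.Geometry.Lorentzian.NormalField (𝓡 3) f') (hpb' : Literature.Geometry.Lorentzian.PseudoRiemannianMetric.contMDiff_pullbackBilin (𝓡 3) X (𝓡 2) S' ((⊤ : ℕ∞) : WithTop ℕ∞)) (hf' : (Literature.Geometry.Lorentzian.PseudoRiemannianMetric.ofRiemannian D.h).IsSpacelikeImmersion (𝓡 2) f') (Ω : TopologicalSpace.Opens X), Manifold.IsSmoothEmbedding (𝓡 2) (𝓡 3) ((⊤ : ℕ∞) : WithTop ℕ∞) f' → Set.range f' ⊆ (U : Set X) → (Literature.Geometry.Lorentzian.PseudoRiemannianMetric.ofRiemannian D.h).IsUnitNormal (𝓡 2) f' ν' 1 → Nonempty S' → frontier (Ω : Set X) = Set.range f' → (∃ R', e.R < R' ∧ Disjoint (e.far R') (Ω : Set X)) → (∀ y, ∀ᶠ t in nhdsWithin (0 : ℝ) (Set.Iio 0), Literature.Geometry.Lorentzian.curveThrough (𝓡 3) (f' y) (ν' y) t ∈ (Ω : Set X)) → ¬ Literature.Geometry.Lorentzian.IsWeaklyOuterTrapped D.h D.k f' hpb' hf' ν'; ContMDiff (𝓡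 2) (𝓡 3).tangent ((⊤ : ℕ∞) : WithTop ℕ∞) (fun y ↦ (Bundle.TotalSpace.mk' Literature.Geometry.Lorentzian.E3 (S.f y) (S.ν y) : TangentBundle (𝓡 3) X)) ∧ D.SatisfiesDominantEnergyCondition ∧ e.IsAsymptoticallyFlat D 1 ∧ D.IsComplete ∧ (∃ m, e.HasADMEnergy D m) ∧ (∀ i, ∃ p, e.HasADMMomentum D i p) ∧ WOTFree S.exterior ∧ IsOutsideOf S.exterior S.surf S.f S.ν ∧ 0 < e.admMass D; ∀ d ∈ Literature.Geometry.Lorentzian.admissibleVacuumData X, ¬ P d → (¬ K pert d ∧ ¬ K collar d ∧ ¬ K shell d ∧ ¬ Mink d) → ¬ AH d → SimplyConnectedSpace X → (¬ ∃ (l : ℝ) (hl : 0 < l), Mink (Literature.Geometry.Lorentzian.InitialDataSet.homothety d l hl)) → ∃ (e : Literature.Geometry.Lorentzian.AFEnd X) (F : EuclideanSpace ℝ (Fin 1) → Literature.Geometry.Lorentzian.InitialDataSet (𝓡 3) X), Literature.Geometry.Lorentzian.InitialDataSet.IsTameDataFamily e 1 F ∧ Literature.Geometry.Lorentzian.InitialDataSet.IsImmersedAtZero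 1 F ∧ F 0 = d ∧ Injective F ∧ (∀ c, F c ∈ Literature.Geometry.Lorentzian.admissibleVacuumData X) ∧ ∀ c ≠ 0, P (F c)

-- parent: HorizonFreeResidual · child (gen 1)
/--     item stmt-FinalStateConjecture-28338 · crux · rank 202 · open
    parent: HorizonFreeResidual · by planner
    why it might fail: one-sided (ℝP²-type) minimal surfaces hide the horizon from the outermost-MOTS machinery: no printed nonlinear stability or settling theorem is posed on a slice with π₁ ≠ 1, and P-generic capture near the ℝP³ geon needs Kerr stability to descend to ℤ₂-quotients along tame lines
    sources: EichmairGallowayPollack2013, arXiv:1204.0278, doi:10.1063/1.522498, arXiv:gr-qc/9305017, Klainerman2025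
[crux · gen-4 cut of HorizonFreeResidual (stmt-FinalStateConjecture-27212), lens-1 g4 node
ScaleTopology · thin · SPECIAL-TYPE (only Cauchy slices X with π₁(X) ≠ 1; the cut is by a property
of X — an invariant of every symmetry of the constraint map — not of d) · WEAKER (lens kernel
hiddenHorizonCapture_of_summit, split_iff; ⇏ parent: silent on X ≅ ℝ³) · dispersal AND every
small-data mechanism are absent here BY THEOREM, not by fiat: Gannon–Lee
(EichmairGallowayPollack2013 Thm 2.1 [arXiv:1204.0278 p.4]; Gannon doi:10.1063/1.522498) ⇒ no
admissible datum on X — hence no member F c of a curing line, which lives on the same X — has a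
null-geodesically complete development, and EichmairGallowayPollack2013 Thm 4.1 / Cor 3.5 [p.8–9,
p.6] ⇒ every such datum carries an IMMERSED MOTS although ¬AH says it has no honest outermost one
(model: the t = 0 slice of the ℝP³ geon, whose unique closed minimal surface is a one-sided ℝP²
[p.6]) · leaf IDEA-NEEDED (capture of hidden / one-sided horizons: the geon exterior IS
Schwarzschild, so the natural conjecture is P-generic capture by ℤ₂-quotients of Kerr basins plus
topological censorship (arXiv:gr-qc/9305017) for the exterior — no printed nonline -/
@[route_item "route-FinalStateConjecture-RootDecompScaleTopology"]
def HiddenHorizonCapture : Prop :=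
  ∀ (X : Type) [TopologicalSpace X] [ChartedSpace Literature.Geometry.Lorentzian.E3 X] [IsManifold (𝓡 3) ((⊤ : ℕ∞) : WithTop ℕ∞) X] [T2Space X] [SecondCountableTopology X] [ConnectedSpace X], let P : Literature.Geometry.Lorentzian.InitialDataSet (𝓡 3) X → Prop := fun D ↦ (∃ 𝒟 : Literature.Geometry.Lorentzian.VacuumCauchyDevelopment D, 𝒟.IsMaximal) ∧ ∀ 𝒟 : Literature.Geometry.Lorentzian.VacuumCauchyDevelopment D, 𝒟.IsMaximal → Summit.FinalStateConjecture.HasCompleteNullInfinity 𝒟.toCauchyDevelopment ∧ ∃ (O : Set 𝒟.carrier) (d : Literature.Geometry.Lorentzian.FinalStateDecomposition 𝒟.toSpacetime O 2), (∀ i, Literature.Geometry.Lorentzian.Kerr.IsSubextremal (d.mass i) (d.spin i)) ∧ O = Summit.FinalStateConjecture.exteriorOf 𝒟.toCauchyDevelopment d.charted ∧ Summit.FinalStateConjecture.RaysStayInClosure 𝒟.toCauchyDevelopment O ∧ Summit.FinalStateConjecture.HasExhaustiveCharts d ∧ Summit.FinalStateConjecture.IsFutureOriented d; let K : Set (ℝ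 × ℝ) → Literature.Geometry.Lorentzian.InitialDataSet (𝓡 3) X → Prop := fun W D ↦ ∀ [Literature.Geometry.Lorentzian.Kerr.Facts] [Literature.Geometry.Lorentzian.Kerr.SliceFacts], ∃ (M a r₀ : ℝ) (hM : 0 < M), |a| < M ∧ (|a| / M, r₀ / M) ∈ W ∧ ∃ (θ : Literature.Geometry.Lorentzian.Kerr.slice a r₀ → X) (hθ : ContMDiff 𝓘(ℝ, Literature.Geometry.Lorentzian.E3) (𝓡 3) (((⊤ : ℕ∞) : WithTop ℕ∞) + 1) θ) (hθ' : ∀ u, Injective (mfderiv 𝓘(ℝ, Literature.Geometry.Lorentzian.E3) (𝓡 3) θ u)), Topology.IsOpenEmbedding θ ∧ IsCompact (range θ)ᶜ ∧ (∀ s' : ℕ, Literature.Geometry.Lorentzian.InitialDataSet.dataWeightedSobolevEDist s' (-1 : ℝ) (D.comap θ hθ hθ') (Literature.Geometry.Lorentzian.Kerr.data M a r₀ hM.le) < ⊤) ∧ Literature.Geometry.Lorentzian.InitialDataSet.dataWeightedSobolevEDist 6 (-1 : ℝ) (D.comap θ hθ hθ') (Literature.Geometry.Lorentzian.Kerr.data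 M a r₀ hM.le) < ENNReal.ofReal 1; let Mink : Literature.Geometry.Lorentzian.InitialDataSet (𝓡 3) X → Prop := fun D ↦ ∃ (θ : Literature.Geometry.Lorentzian.Minkowski.slice → X) (hθ : ContMDiff 𝓘(ℝ, Literature.Geometry.Lorentzian.E3) (𝓡 3) (((⊤ : ℕ∞) : WithTop ℕ∞) + 1) θ) (hθ' : ∀ u, Injective (mfderiv 𝓘(ℝ, Literature.Geometry.Lorentzian.E3) (𝓡 3) θ u)), Topology.IsOpenEmbedding θ ∧ Surjective θ ∧ (∀ s' : ℕ, Literature.Geometry.Lorentzian.InitialDataSet.dataWeightedSobolevEDist s' (-1 : ℝ) (D.comap θ hθ hθ') Literature.Geometry.Lorentzian.trivialData < ⊤) ∧ Literature.Geometry.Lorentzian.InitialDataSet.dataWeightedSobolevEDist 6 (-1 : ℝ) (D.comap θ hθ hθ') Literature.Geometry.Lorentzian.trivialData < ENNReal.ofReal 1; let pert : Set (ℝ × ℝ) := {p | p.1 ≤ (9 / 10 : ℝ) ∧ 1 - Real.sqrt (1 - p.1 ^ 2) < p.2 ∧ p.2 < 1 + Real.sqrt (1 - p.1 ^ 2)};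 let collar : Set (ℝ × ℝ) := {p | (9 / 10 : ℝ) < p.1 ∧ 1 - Real.sqrt (1 - p.1 ^ 2) < p.2 ∧ p.2 < 1 + Real.sqrt (1 - p.1 ^ 2)}; let shell : Set (ℝ × ℝ) := {p | 1 + Real.sqrt (1 - p.1 ^ 2) ≤ p.2 ∧ p.2 ≤ 3}; let AH : Literature.Geometry.Lorentzian.InitialDataSet (𝓡 3) X → Prop := fun D ↦ ∃ (hLC : D.metric.HasLeviCivita) (e : Literature.Geometry.Lorentzian.AFEnd X) (S : Literature.Geometry.Lorentzian.OutermostMOTS (𝓡 3) D.h D.k), haveI : (Literature.Geometry.Lorentzian.PseudoRiemannianMetric.ofRiemannian D.h).HasLeviCivita := hLC; let IsExteriorRegion : TopologicalSpace.Opens X → Prop := fun U ↦ IsConnected (U : Set X) ∧ ∃ R', e.R < R' ∧ e.far R' ⊆ (U : Set X) ∧ IsCompact (closure (U : Set X) \ e.far R'); let IsOutsideOf : TopologicalSpace.Opens X → (S' : Type) → (f' : S' → X) → Literature.Geometry.Lorentzian.NormalField (𝓡 3) f' → Prop := fun U _ f' ν' ↦ frontier (U : Set X) = Set.range f' ∧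 (∀ y, ∀ᶠ t in nhdsWithin (0 : ℝ) (Set.Ioi 0), Literature.Geometry.Lorentzian.curveThrough (𝓡 3) (f' y) (ν' y) t ∈ (U : Set X)) ∧ (∀ y, ∀ᶠ t in nhdsWithin (0 : ℝ) (Set.Iio 0), Literature.Geometry.Lorentzian.curveThrough (𝓡 3) (f' y) (ν' y) t ∉ closure (U : Set X)) ∧ IsExteriorRegion U; let WOTFree : TopologicalSpace.Opens X → Prop := fun U ↦ ∀ (S' : Type) [TopologicalSpace S'] [ChartedSpace (EuclideanSpace ℝ (Fin 2)) S'] [IsManifold (𝓡 2) ((⊤ : ℕ∞) : WithTop ℕ∞) S'] [CompactSpace S'] [T2Space S'] (f' : S' → X) (ν' : Literature.Geometry.Lorentzian.NormalField (𝓡 3) f') (hpb' : Literature.Geometry.Lorentzian.PseudoRiemannianMetric.contMDiff_pullbackBilin (𝓡 3) X (𝓡 2) S' ((⊤ : ℕ∞) : WithTop ℕ∞)) (hf' : (Literature.Geometry.Lorentzian.PseudoRiemannianMetric.ofRiemannian D.h).IsSpacelikeImmersion (𝓡 2) f') (Ω : TopologicalSpace.Opens X), Manifold.IsSmoothEmbedding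 (𝓡 2) (𝓡 3) ((⊤ : ℕ∞) : WithTop ℕ∞) f' → Set.range f' ⊆ (U : Set X) → (Literature.Geometry.Lorentzian.PseudoRiemannianMetric.ofRiemannian D.h).IsUnitNormal (𝓡 2) f' ν' 1 → Nonempty S' → frontier (Ω : Set X) = Set.range f' → (∃ R', e.R < R' ∧ Disjoint (e.far R') (Ω : Set X)) → (∀ y, ∀ᶠ t in nhdsWithin (0 : ℝ) (Set.Iio 0), Literature.Geometry.Lorentzian.curveThrough (𝓡 3) (f' y) (ν' y) t ∈ (Ω : Set X)) → ¬ Literature.Geometry.Lorentzian.IsWeaklyOuterTrapped D.h D.k f' hpb' hf' ν'; ContMDiff (𝓡 2) (𝓡 3).tangent ((⊤ : ℕ∞) : WithTop ℕ∞) (fun y ↦ (Bundle.TotalSpace.mk' Literature.Geometry.Lorentzian.E3 (S.f y) (S.ν y) : TangentBundle (𝓡 3) X)) ∧ D.SatisfiesDominantEnergyCondition ∧ e.IsAsymptoticallyFlat D 1 ∧ D.IsComplete ∧ (∃ m, e.HasADMEnergy D m) ∧ (∀ i, ∃ p, e.HasADMMomentum D i p) ∧ WOTFree S.exterior ∧ IsOutsideOf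 S.exterior S.surf S.f S.ν ∧ 0 < e.admMass D; ∀ d ∈ Literature.Geometry.Lorentzian.admissibleVacuumData X, ¬ P d → (¬ K pert d ∧ ¬ K collar d ∧ ¬ K shell d ∧ ¬ Mink d) → ¬ AH d → ¬ SimplyConnectedSpace X → ∃ (e : Literature.Geometry.Lorentzian.AFEnd X) (F : EuclideanSpace ℝ (Fin 1) → Literature.Geometry.Lorentzian.InitialDataSet (𝓡 3) X), Literature.Geometry.Lorentzian.InitialDataSet.IsTameDataFamily e 1 F ∧ Literature.Geometry.Lorentzian.InitialDataSet.IsImmersedAtZero 1 F ∧ F 0 = d ∧ Injective F ∧ (∀ c, F c ∈ Literature.Geometry.Lorentzian.admissibleVacuumData X) ∧ ∀ c ≠ 0, P (F c)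

-- parent: HorizonFreeResidual · child (gen 1)
/--     item stmt-FinalStateConjecture-28339 · crux · rank 203 · open
    parent: HorizonFreeResidual · by planner
    why it might fail: only through its dominator and ports: the tame exit of 25093 must transport under homothety in the weighted far-end norms (S4 TameExitDilation, lens-6 port, typing open) and P must descend along dilations of maximal developments (S3); if either fails, unit-far blow-ups of small data stay uncured
    sources: ChristodoulouKlainerman1993, arXiv:math/0411109, arXiv:0904.0620, Christodoulou1999, BartnikIsenberg2004
[crux · gen-4 cut of HorizonFreeResidual (stmt-FinalStateConjecture-27212), lens-1 g4 node
ScaleTopology · caution c7 applied to N1's absolute-radius Minkowski cell: the SCALE SATURATION of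
the born let Mink (unit H⁶₋₁ ball about trivial data passed by SOME homothetic copy (l²h, lk), l > 0
— kernel Sm, sm_homothety_iff; saturation is genuine: (λ²−1)·δ ∉ H⁶₋₁, kernel not_sm_homothety_iff)
· WEAKER (lens kernel scaledSmallDispersal_of_summit; ⇏ parent) · NOT a new mechanism — THE
PARK-RULE RUNG of this cut · ATTACKABLE NOW — DOMINATED by the born sibling SmallDataDispersal
(stmt-FinalStateConjecture-25093) through the dilation covariance of the vacuum Cauchy problem: lens
kernel scaledSmallDispersal_of_ports : AdmissibleDilationClosed → CureScaleCovariant →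
TameExitDilation → SmallDataDispersal → ScaledSmallDispersal, and closes₈_of_ports (S1
AdmissibleDilationClosed = lens-6 g4's text verbatim, in tree as
Theorems.CaptureSuffices.CaptureExportsCensorshipDiagonalSurgery.homothety_mem_admissibleVacuumData;
S3 CureScaleCovariant «P (l·d) → P d» ≙ lens-6 SummitPropDilationDescends; S4 TameExitDilation =
lens-6's port — ONE porting job serves this leaf AND RootDecompCensoredShadow's Boun -/
@[route_item "route-FinalStateConjecture-RootDecompScaleTopology"]
def ScaledSmallDispersal : Prop :=
  ∀ (X : Type) [TopologicalSpace X] [ChartedSpace Literature.Geometry.Lorentzian.E3 X] [IsManifold (𝓡 3) ((⊤ : ℕ∞) : WithTop ℕ∞) X] [T2Space X] [SecondCountableTopology X] [ConnectedSpace X], let P : Literature.Geometry.Lorentzian.InitialDataSet (𝓡 3) X → Prop := fun D ↦ (∃ 𝒟 : Literature.Geometry.Lorentzian.VacuumCauchyDevelopment D, 𝒟.IsMaximal) ∧ ∀ 𝒟 : Literature.Geometry.Lorentzian.VacuumCauchyDevelopment D, 𝒟.IsMaximal → Summit.FinalStateConjecture.HasCompleteNullInfinity 𝒟.toCauchyDevelopment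 ∧ ∃ (O : Set 𝒟.carrier) (d : Literature.Geometry.Lorentzian.FinalStateDecomposition 𝒟.toSpacetime O 2), (∀ i, Literature.Geometry.Lorentzian.Kerr.IsSubextremal (d.mass i) (d.spin i)) ∧ O = Summit.FinalStateConjecture.exteriorOf 𝒟.toCauchyDevelopment d.charted ∧ Summit.FinalStateConjecture.RaysStayInClosure 𝒟.toCauchyDevelopment O ∧ Summit.FinalStateConjecture.HasExhaustiveCharts d ∧ Summit.FinalStateConjecture.IsFutureOriented d; let K : Set (ℝ × ℝ) → Literature.Geometry.Lorentzian.InitialDataSet (𝓡 3) X → Prop := fun W D ↦ ∀ [Literature.Geometry.Lorentzian.Kerr.Facts] [Literature.Geometry.Lorentzian.Kerr.SliceFacts], ∃ (M a r₀ : ℝ) (hM : 0 < M), |a| < M ∧ (|a| / M, r₀ / M) ∈ W ∧ ∃ (θ : Literature.Geometry.Lorentzian.Kerr.slice a r₀ → X) (hθ : ContMDiff 𝓘(ℝ, Literature.Geometry.Lorentzian.E3) (𝓡 3) (((⊤ : ℕ∞) : WithTop ℕ∞) + 1) θ) (hθ' : ∀ u, Injective (mfderiv 𝓘(ℝ, Literature.Geometry.Lorentzian.E3)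 (𝓡 3) θ u)), Topology.IsOpenEmbedding θ ∧ IsCompact (range θ)ᶜ ∧ (∀ s' : ℕ, Literature.Geometry.Lorentzian.InitialDataSet.dataWeightedSobolevEDist s' (-1 : ℝ) (D.comap θ hθ hθ') (Literature.Geometry.Lorentzian.Kerr.data M a r₀ hM.le) < ⊤) ∧ Literature.Geometry.Lorentzian.InitialDataSet.dataWeightedSobolevEDist 6 (-1 : ℝ) (D.comap θ hθ hθ') (Literature.Geometry.Lorentzian.Kerr.data M a r₀ hM.le) < ENNReal.ofReal 1; let Mink : Literature.Geometry.Lorentzian.InitialDataSet (𝓡 3) X → Prop := fun D ↦ ∃ (θ : Literature.Geometry.Lorentzian.Minkowski.slice → X) (hθ : ContMDiff 𝓘(ℝ, Literature.Geometry.Lorentzian.E3) (𝓡 3) (((⊤ : ℕ∞) : WithTop ℕ∞) + 1) θ) (hθ' : ∀ u, Injective (mfderiv 𝓘(ℝ, Literature.Geometry.Lorentzian.E3) (𝓡 3) θ u)), Topology.IsOpenEmbedding θ ∧ Surjective θ ∧ (∀ s' : ℕ, Literature.Geometry.Lorentzian.InitialDataSet.dataWeightedSobolevEDist s' (-1 :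 ℝ) (D.comap θ hθ hθ') Literature.Geometry.Lorentzian.trivialData < ⊤) ∧ Literature.Geometry.Lorentzian.InitialDataSet.dataWeightedSobolevEDist 6 (-1 : ℝ) (D.comap θ hθ hθ') Literature.Geometry.Lorentzian.trivialData < ENNReal.ofReal 1; let pert : Set (ℝ × ℝ) := {p | p.1 ≤ (9 / 10 : ℝ) ∧ 1 - Real.sqrt (1 - p.1 ^ 2) < p.2 ∧ p.2 < 1 + Real.sqrt (1 - p.1 ^ 2)}; let collar : Set (ℝ × ℝ) := {p | (9 / 10 : ℝ) < p.1 ∧ 1 - Real.sqrt (1 - p.1 ^ 2) < p.2 ∧ p.2 < 1 + Real.sqrt (1 - p.1 ^ 2)}; let shell : Set (ℝ × ℝ) := {p | 1 + Real.sqrt (1 - p.1 ^ 2) ≤ p.2 ∧ p.2 ≤ 3}; let AH : Literature.Geometry.Lorentzian.InitialDataSet (𝓡 3) X → Prop := fun D ↦ ∃ (hLC : D.metric.HasLeviCivita) (e : Literature.Geometry.Lorentzian.AFEnd X) (S : Literature.Geometry.Lorentzian.OutermostMOTS (𝓡 3) D.h D.k), haveI : (Literature.Geometry.Lorentzian.PseudoRiemannianMetric.ofRiemannian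 D.h).HasLeviCivita := hLC; let IsExteriorRegion : TopologicalSpace.Opens X → Prop := fun U ↦ IsConnected (U : Set X) ∧ ∃ R', e.R < R' ∧ e.far R' ⊆ (U : Set X) ∧ IsCompact (closure (U : Set X) \ e.far R'); let IsOutsideOf : TopologicalSpace.Opens X → (S' : Type) → (f' : S' → X) → Literature.Geometry.Lorentzian.NormalField (𝓡 3) f' → Prop := fun U _ f' ν' ↦ frontier (U : Set X) = Set.range f' ∧ (∀ y, ∀ᶠ t in nhdsWithin (0 : ℝ) (Set.Ioi 0), Literature.Geometry.Lorentzian.curveThrough (𝓡 3) (f' y) (ν' y) t ∈ (U : Set X)) ∧ (∀ y, ∀ᶠ t in nhdsWithin (0 : ℝ) (Set.Iio 0), Literature.Geometry.Lorentzian.curveThrough (𝓡 3) (f' y) (ν' y) t ∉ closure (U : Set X)) ∧ IsExteriorRegion U; let WOTFree : TopologicalSpace.Opens X → Prop := fun U ↦ ∀ (S' : Type) [TopologicalSpace S'] [ChartedSpace (EuclideanSpace ℝ (Fin 2)) S'] [IsManifold (𝓡 2) ((⊤ : ℕ∞) : WithTop ℕ∞) S'] [CompactSpace S'] [T2Space S']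 (f' : S' → X) (ν' : Literature.Geometry.Lorentzian.NormalField (𝓡 3) f') (hpb' : Literature.Geometry.Lorentzian.PseudoRiemannianMetric.contMDiff_pullbackBilin (𝓡 3) X (𝓡 2) S' ((⊤ : ℕ∞) : WithTop ℕ∞)) (hf' : (Literature.Geometry.Lorentzian.PseudoRiemannianMetric.ofRiemannian D.h).IsSpacelikeImmersion (𝓡 2) f') (Ω : TopologicalSpace.Opens X), Manifold.IsSmoothEmbedding (𝓡 2) (𝓡 3) ((⊤ : ℕ∞) : WithTop ℕ∞) f' → Set.range f' ⊆ (U : Set X) → (Literature.Geometry.Lorentzian.PseudoRiemannianMetric.ofRiemannian D.h).IsUnitNormal (𝓡 2) f' ν' 1 → Nonempty S' → frontier (Ω : Set X) = Set.range f' → (∃ R', e.R < R' ∧ Disjoint (e.far R') (Ω : Set X)) → (∀ y, ∀ᶠ t in nhdsWithin (0 : ℝ) (Set.Iio 0), Literature.Geometry.Lorentzian.curveThrough (𝓡 3) (f' y) (ν' y) t ∈ (Ω : Set X)) → ¬ Literature.Geometry.Lorentzian.IsWeaklyOuterTrapped D.h D.k f' hpb' hf' ν'; ContMDiff (𝓡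 2) (𝓡 3).tangent ((⊤ : ℕ∞) : WithTop ℕ∞) (fun y ↦ (Bundle.TotalSpace.mk' Literature.Geometry.Lorentzian.E3 (S.f y) (S.ν y) : TangentBundle (𝓡 3) X)) ∧ D.SatisfiesDominantEnergyCondition ∧ e.IsAsymptoticallyFlat D 1 ∧ D.IsComplete ∧ (∃ m, e.HasADMEnergy D m) ∧ (∀ i, ∃ p, e.HasADMMomentum D i p) ∧ WOTFree S.exterior ∧ IsOutsideOf S.exterior S.surf S.f S.ν ∧ 0 < e.admMass D; ∀ d ∈ Literature.Geometry.Lorentzian.admissibleVacuumData X, ¬ P d → (¬ K pert d ∧ ¬ K collar d ∧ ¬ K shell d ∧ ¬ Mink d) → ¬ AH d → (∃ (l : ℝ) (hl : 0 < l), Mink (Literature.Geometry.Lorentzian.InitialDataSet.homothety d l hl)) → ∃ (e : Literature.Geometry.Lorentzian.AFEnd X) (F : EuclideanSpace ℝ (Fin 1) → Literature.Geometry.Lorentzian.InitialDataSet (𝓡 3) X), Literature.Geometry.Lorentzian.InitialDataSet.IsTameDataFamily e 1 F ∧ Literature.Geometry.Lorentzian.InitialDataSet.IsImmersedAtZero 1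 F ∧ F 0 = d ∧ Injective F ∧ (∀ c, F c ∈ Literature.Geometry.Lorentzian.admissibleVacuumData X) ∧ ∀ c ≠ 0, P (F c)

-- parent: HorizonFreeResidual · glue (gen 1)
/--     item stmt-FinalStateConjecture-28340 · support · rank 204 · open
    parent: HorizonFreeResidual · GLUE: children ⟹ parent · by planner
HiddenHorizonCapture → ScaledSmallDispersal → GenuinelyLargeResidual → HorizonFreeResidual -/
@[route_item "route-FinalStateConjecture-RootDecompScaleTopology"]
def HorizonFreeResidualGlue : Prop :=
  GenuinelyLargeResidual → HiddenHorizonCapture → ScaledSmallDispersal → HorizonFreeResidual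

/-- item stmt-FinalStateConjecture-27211 · crux · rank 3 · open · by planner
why it might fail: capture given a certified but subdominant hole is open far from Kerr: comparable-mass two-hole data (Brill–Lindquist/Misner beyond the common-MOTS fold) may radiate, recoil or fragment so that no tame line through d reaches P; the born MOTS guard is slicing-sensitive (Wald–Iyer).
sources: arXiv:1109.2165, arXiv:gr-qc/9910040, Christodoulou1999, arXiv:1310.4209, doi:10.1007/978-3-662-46035-1
[crux · gen-3 glued split of SubPenroseResidual (stmt-26561), lens-1 g3 node «HorizonLadder v2»
(HOME/decomp-fsc-lens-1/g3/HorizonLadder.lean @8334e482), CLEARED by decomp-fsc-crit-1-g0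
2026-08-30T03:49:27Z; filing form (b): split ON the thin sibling RootDecompHorizonLadder where 26561
is top-level by signature · WEAKER (S ⟹ it; probes P1/P3/P5 not closed) · thin · IDEA-NEEDED +
INSTRUMENTABLE (census asks T-H1′/T-H2′: K4 comparable-mass Brill–Lindquist/Misner-type pairs beyond
the common-MOTS fold with ratio < 0.9 live here) · slicing-honesty caveat carried (NODE-g3.md §5(g))
· relieved BY THEOREM of the formation/dispersal alternative (outermost MOTS + non-compact Cauchy
surface ⟹ null-incomplete MGHD [corpus:ashtekar2015 p.541])] SUBDOMINANT-HORIZON RESIDUAL: for every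
Σ and every admissible datum d outside the four model cells (perturbative / near-extremal /
enclosed-core Kerr cells, Minkowski cell — the born residual guard R d) at which an APPARENT HORIZON
IS PRESENT in the born sense (AH d := the born «let Hor» body with its Penrose-ratio conjunct
dropped: a two-sided outermost MOTS in the born currency, floor rung p̄ = 0, kernel
hor_zero_iff_apparentHorizonB) but the born ho -/
@[route_item "route-FinalStateConjecture-RootDecompScaleTopology", crux]
def SubdominantHorizonResidual : Prop :=
  ∀ (X : Type) [TopologicalSpace X] [ChartedSpace Literature.Geometry.Lorentzian.E3 X] [IsManifold (𝓡 3) ((⊤ : ℕ∞) : WithTop ℕ∞) X] [T2Space X] [SecondCountableTopology X] [ConnectedSpace X], let P : Literature.Geometry.Lorentzian.InitialDataSet (𝓡 3) X → Prop := fun D ↦ (∃ 𝒟 : Literature.Geometry.Lorentzian.VacuumCauchyDevelopment D, 𝒟.IsMaximal) ∧ ∀ 𝒟 : Literature.Geometry.Lorentzian.VacuumCauchyDevelopment D, 𝒟.IsMaximal → Summit.FinalStateConjecture.HasCompleteNullInfinity 𝒟.toCauchyDevelopment ∧ ∃ (O : Set 𝒟.carrier) (d : Literature.Geometry.Lorentzian.FinalStateDecomposition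 𝒟.toSpacetime O 2), (∀ i, Literature.Geometry.Lorentzian.Kerr.IsSubextremal (d.mass i) (d.spin i)) ∧ O = Summit.FinalStateConjecture.exteriorOf 𝒟.toCauchyDevelopment d.charted ∧ Summit.FinalStateConjecture.RaysStayInClosure 𝒟.toCauchyDevelopment O ∧ Summit.FinalStateConjecture.HasExhaustiveCharts d ∧ Summit.FinalStateConjecture.IsFutureOriented d; let K : Set (ℝ × ℝ) → Literature.Geometry.Lorentzian.InitialDataSet (𝓡 3) X → Prop := fun W D ↦ ∀ [Literature.Geometry.Lorentzian.Kerr.Facts] [Literature.Geometry.Lorentzian.Kerr.SliceFacts], ∃ (M a r₀ : ℝ) (hM : 0 < M), |a| < M ∧ (|a| / M, r₀ / M) ∈ W ∧ ∃ (θ : Literature.Geometry.Lorentzian.Kerr.slice a r₀ → X) (hθ : ContMDiff 𝓘(ℝ, Literature.Geometry.Lorentzian.E3) (𝓡 3) (((⊤ : ℕ∞) : WithTop ℕ∞) + 1) θ) (hθ' : ∀ u, Injective (mfderiv 𝓘(ℝ, Literature.Geometry.Lorentzian.E3) (𝓡 3) θ u)), Topology.IsOpenEmbedding θ ∧ IsCompact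 (range θ)ᶜ ∧ (∀ s' : ℕ, Literature.Geometry.Lorentzian.InitialDataSet.dataWeightedSobolevEDist s' (-1 : ℝ) (D.comap θ hθ hθ') (Literature.Geometry.Lorentzian.Kerr.data M a r₀ hM.le) < ⊤) ∧ Literature.Geometry.Lorentzian.InitialDataSet.dataWeightedSobolevEDist 6 (-1 : ℝ) (D.comap θ hθ hθ') (Literature.Geometry.Lorentzian.Kerr.data M a r₀ hM.le) < ENNReal.ofReal 1; let Mink : Literature.Geometry.Lorentzian.InitialDataSet (𝓡 3) X → Prop := fun D ↦ ∃ (θ : Literature.Geometry.Lorentzian.Minkowski.slice → X) (hθ : ContMDiff 𝓘(ℝ, Literature.Geometry.Lorentzian.E3) (𝓡 3) (((⊤ : ℕ∞) : WithTop ℕ∞) + 1) θ) (hθ' : ∀ u, Injective (mfderiv 𝓘(ℝ, Literature.Geometry.Lorentzian.E3) (𝓡 3) θ u)), Topology.IsOpenEmbedding θ ∧ Surjective θ ∧ (∀ s' : ℕ, Literature.Geometry.Lorentzian.InitialDataSet.dataWeightedSobolevEDist s' (-1 : ℝ) (D.comap θ hθ hθ') Literature.Geometry.Lorentzian.trivialData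 < ⊤) ∧ Literature.Geometry.Lorentzian.InitialDataSet.dataWeightedSobolevEDist 6 (-1 : ℝ) (D.comap θ hθ hθ') Literature.Geometry.Lorentzian.trivialData < ENNReal.ofReal 1; let pert : Set (ℝ × ℝ) := {p | p.1 ≤ (9 / 10 : ℝ) ∧ 1 - Real.sqrt (1 - p.1 ^ 2) < p.2 ∧ p.2 < 1 + Real.sqrt (1 - p.1 ^ 2)}; let collar : Set (ℝ × ℝ) := {p | (9 / 10 : ℝ) < p.1 ∧ 1 - Real.sqrt (1 - p.1 ^ 2) < p.2 ∧ p.2 < 1 + Real.sqrt (1 - p.1 ^ 2)}; let shell : Set (ℝ × ℝ) := {p | 1 + Real.sqrt (1 - p.1 ^ 2) ≤ p.2 ∧ p.2 ≤ 3}; let Hor : Literature.Geometry.Lorentzian.InitialDataSet (𝓡 3) X → Prop := fun D ↦ ∃ (hLC : D.metric.HasLeviCivita) (e : Literature.Geometry.Lorentzian.AFEnd X) (S : Literature.Geometry.Lorentzian.OutermostMOTS (𝓡 3) D.h D.k), haveI : (Literature.Geometry.Lorentzian.PseudoRiemannianMetric.ofRiemannian D.h).HasLeviCivita := hLC; let IsExteriorRegion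 : TopologicalSpace.Opens X → Prop := fun U ↦ IsConnected (U : Set X) ∧ ∃ R', e.R < R' ∧ e.far R' ⊆ (U : Set X) ∧ IsCompact (closure (U : Set X) \ e.far R'); let IsOutsideOf : TopologicalSpace.Opens X → (S' : Type) → (f' : S' → X) → Literature.Geometry.Lorentzian.NormalField (𝓡 3) f' → Prop := fun U _ f' ν' ↦ frontier (U : Set X) = Set.range f' ∧ (∀ y, ∀ᶠ t in nhdsWithin (0 : ℝ) (Set.Ioi 0), Literature.Geometry.Lorentzian.curveThrough (𝓡 3) (f' y) (ν' y) t ∈ (U : Set X)) ∧ (∀ y, ∀ᶠ t in nhdsWithin (0 : ℝ) (Set.Iio 0), Literature.Geometry.Lorentzian.curveThrough (𝓡 3) (f' y) (ν' y) t ∉ closure (U : Set X)) ∧ IsExteriorRegion U; let IsCalS : TopologicalSpace.Opens X → Prop := fun V ↦ ∃ (S' : Type) (_ : TopologicalSpace S') (_ : ChartedSpace (EuclideanSpace ℝ (Fin 2)) S') (_ : IsManifold (𝓡 2) ((⊤ : ℕ∞) : WithTop ℕ∞) S') (_ : CompactSpace S') (_ : T2Space S') (f' : S' → X) (ν' : Literature.Geometry.Lorentzian.NormalField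 (𝓡 3) f'), Manifold.IsSmoothEmbedding (𝓡 2) (𝓡 3) ((⊤ : ℕ∞) : WithTop ℕ∞) f' ∧ (Literature.Geometry.Lorentzian.PseudoRiemannianMetric.ofRiemannian D.h).IsUnitNormal (𝓡 2) f' ν' 1 ∧ IsOutsideOf V S' f' ν'; let WOTFree : TopologicalSpace.Opens X → Prop := fun U ↦ ∀ (S' : Type) [TopologicalSpace S'] [ChartedSpace (EuclideanSpace ℝ (Fin 2)) S'] [IsManifold (𝓡 2) ((⊤ : ℕ∞) : WithTop ℕ∞) S'] [CompactSpace S'] [T2Space S'] (f' : S' → X) (ν' : Literature.Geometry.Lorentzian.NormalField (𝓡 3) f') (hpb' : Literature.Geometry.Lorentzian.PseudoRiemannianMetric.contMDiff_pullbackBilin (𝓡 3) X (𝓡 2) S' ((⊤ : ℕ∞) : WithTop ℕ∞)) (hf' : (Literature.Geometry.Lorentzian.PseudoRiemannianMetric.ofRiemannian D.h).IsSpacelikeImmersion (𝓡 2) f') (Ω : TopologicalSpace.Opens X), Manifold.IsSmoothEmbedding (𝓡 2) (𝓡 3) ((⊤ : ℕ∞) : WithTop ℕ∞) f' → Set.range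 f' ⊆ (U : Set X) → (Literature.Geometry.Lorentzian.PseudoRiemannianMetric.ofRiemannian D.h).IsUnitNormal (𝓡 2) f' ν' 1 → Nonempty S' → frontier (Ω : Set X) = Set.range f' → (∃ R', e.R < R' ∧ Disjoint (e.far R') (Ω : Set X)) → (∀ y, ∀ᶠ t in nhdsWithin (0 : ℝ) (Set.Iio 0), Literature.Geometry.Lorentzian.curveThrough (𝓡 3) (f' y) (ν' y) t ∈ (Ω : Set X)) → ¬ Literature.Geometry.Lorentzian.IsWeaklyOuterTrapped D.h D.k f' hpb' hf' ν'; ContMDiff (𝓡 2) (𝓡 3).tangent ((⊤ : ℕ∞) : WithTop ℕ∞) (fun y ↦ (Bundle.TotalSpace.mk' Literature.Geometry.Lorentzian.E3 (S.f y) (S.ν y) : TangentBundle (𝓡 3) X)) ∧ D.SatisfiesDominantEnergyCondition ∧ e.IsAsymptoticallyFlat D 1 ∧ D.IsComplete ∧ (∃ m, e.HasADMEnergy D m) ∧ (∀ i, ∃ p, e.HasADMMomentum D i p) ∧ WOTFree S.exterior ∧ IsOutsideOf S.exterior S.surf S.f S.ν ∧ 0 < e.admMass D ∧ (letI : MeasurableSpace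 X := borel X; haveI : BorelSpace X := ⟨rfl⟩; haveI : LocallyCompactSpace X := ChartedSpace.locallyCompactSpace Literature.Geometry.Lorentzian.E3 X; (9 / 10 : ℝ) * e.admMass D ≤ Real.sqrt ((⨅ (V : TopologicalSpace.Opens X) (_ : IsCalS V ∧ V ≤ S.exterior), Literature.Geometry.Lorentzian.area D.h (frontier (V : Set X))).toReal / (16 * Real.pi))); let AH : Literature.Geometry.Lorentzian.InitialDataSet (𝓡 3) X → Prop := fun D ↦ ∃ (hLC : D.metric.HasLeviCivita) (e : Literature.Geometry.Lorentzian.AFEnd X) (S : Literature.Geometry.Lorentzian.OutermostMOTS (𝓡 3) D.h D.k), haveI : (Literature.Geometry.Lorentzian.PseudoRiemannianMetric.ofRiemannian D.h).HasLeviCivita := hLC; let IsExteriorRegion : TopologicalSpace.Opens X → Prop := fun U ↦ IsConnected (U : Set X) ∧ ∃ R', e.R < R' ∧ e.far R' ⊆ (U : Set X) ∧ IsCompact (closure (U : Set X) \ e.far R'); let IsOutsideOf : TopologicalSpace.Opens X → (S' : Type) → (f' : S' → X) → Literature.Geometry.Lorentzian.NormalField (𝓡 3) f' → Prop := fun U _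 f' ν' ↦ frontier (U : Set X) = Set.range f' ∧ (∀ y, ∀ᶠ t in nhdsWithin (0 : ℝ) (Set.Ioi 0), Literature.Geometry.Lorentzian.curveThrough (𝓡 3) (f' y) (ν' y) t ∈ (U : Set X)) ∧ (∀ y, ∀ᶠ t in nhdsWithin (0 : ℝ) (Set.Iio 0), Literature.Geometry.Lorentzian.curveThrough (𝓡 3) (f' y) (ν' y) t ∉ closure (U : Set X)) ∧ IsExteriorRegion U; let WOTFree : TopologicalSpace.Opens X → Prop := fun U ↦ ∀ (S' : Type) [TopologicalSpace S'] [ChartedSpace (EuclideanSpace ℝ (Fin 2)) S'] [IsManifold (𝓡 2) ((⊤ : ℕ∞) : WithTop ℕ∞) S'] [CompactSpace S'] [T2Space S'] (f' : S' → X) (ν' : Literature.Geometry.Lorentzian.NormalField (𝓡 3) f') (hpb' : Literature.Geometry.Lorentzian.PseudoRiemannianMetric.contMDiff_pullbackBilin (𝓡 3) X (𝓡 2) S' ((⊤ : ℕ∞) : WithTop ℕ∞)) (hf' : (Literature.Geometry.Lorentzian.PseudoRiemannianMetric.ofRiemannian D.h).IsSpacelikeImmersion (𝓡 2) f') (Ω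 : TopologicalSpace.Opens X), Manifold.IsSmoothEmbedding (𝓡 2) (𝓡 3) ((⊤ : ℕ∞) : WithTop ℕ∞) f' → Set.range f' ⊆ (U : Set X) → (Literature.Geometry.Lorentzian.PseudoRiemannianMetric.ofRiemannian D.h).IsUnitNormal (𝓡 2) f' ν' 1 → Nonempty S' → frontier (Ω : Set X) = Set.range f' → (∃ R', e.R < R' ∧ Disjoint (e.far R') (Ω : Set X)) → (∀ y, ∀ᶠ t in nhdsWithin (0 : ℝ) (Set.Iio 0), Literature.Geometry.Lorentzian.curveThrough (𝓡 3) (f' y) (ν' y) t ∈ (Ω : Set X)) → ¬ Literature.Geometry.Lorentzian.IsWeaklyOuterTrapped D.h D.k f' hpb' hf' ν'; ContMDiff (𝓡 2) (𝓡 3).tangent ((⊤ : ℕ∞) : WithTop ℕ∞) (fun y ↦ (Bundle.TotalSpace.mk' Literature.Geometry.Lorentzian.E3 (S.f y) (S.ν y) : TangentBundle (𝓡 3) X)) ∧ D.SatisfiesDominantEnergyCondition ∧ e.IsAsymptoticallyFlat D 1 ∧ D.IsComplete ∧ (∃ m, e.HasADMEnergy D m) ∧ (∀ i, ∃ p, e.HasADMMomentum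 D i p) ∧ WOTFree S.exterior ∧ IsOutsideOf S.exterior S.surf S.f S.ν ∧ 0 < e.admMass D; ∀ d ∈ Literature.Geometry.Lorentzian.admissibleVacuumData X, ¬ P d → (¬ K pert d ∧ ¬ K collar d ∧ ¬ K shell d ∧ ¬ Mink d) → AH d → ¬ Hor d → ∃ (e : Literature.Geometry.Lorentzian.AFEnd X) (F : EuclideanSpace ℝ (Fin 1) → Literature.Geometry.Lorentzian.InitialDataSet (𝓡 3) X), Literature.Geometry.Lorentzian.InitialDataSet.IsTameDataFamily e 1 F ∧ Literature.Geometry.Lorentzian.InitialDataSet.IsImmersedAtZero 1 F ∧ F 0 = d ∧ Injective F ∧ (∀ c, F c ∈ Literature.Geometry.Lorentzian.admissibleVacuumData X) ∧ ∀ c ≠ 0, P (F c)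

/-- item stmt-FinalStateConjecture-26560 · crux · rank 4 · open · by planner
why it might fail: Near-saturating apparent horizons do not control the exterior in the H^s norms Kerr stability consumes (Lee–Sormani, Allen, Dong: weak norms only); a laminated capture threshold inside 𝓗(9/10) (comparable spectators just under the 10 % budget) would defeat tame exits.
sources: arXiv:1109.2165, arXiv:1705.00591, doi:10.2140/gt.2025.29.4911, arXiv:2304.08455, Christodoulou1999
[crux · gen-2 glued split of ExtendedFieldResidual (stmt-25091), lens-1 g2 node HorizonSplit,
CLEARED[+follow-ups F1–F3] by decomp-fsc-crit-1-g0 2026-08-30T02:58:30Z; child A = S-exit on R ∩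
𝓗(9/10): the residual data (unit-far from every model tube of the born tuple (6,−1,1,9/10,3,1))
whose slice carries an outermost MOTS S bounding the sole end's exterior, WOT-free outside, m_ADM >
0 and ENCLOSURE Penrose ratio √(A_min(S)/16π) ≥ (9/10)·m_ADM; RESIDUAL-relieved · WEAKER (kernel
horizonDominatedResidualAt_of_summit, split_iff; probes A → S / A → parent fail) · COUNTS-candidate
→ COUNTS once F1 (kernel Hor_core_iff_of_admissible on admissible data) lands (critic 03:16:15Z: F2
inhabitant SATISFIED at print level — late slices of one-ended collapse radiating < 19 %; F3: the p̄
= 1, k = 0 stratum is DECORATIVE-true either way and is NOT a rung of this piece) ·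
IDEA-NEEDED[U_rate] (caution c4 F8 topology mismatch applies to any porting reading) (no theorem
evolves large vacuum data containing a MOTS to a settled exterior; near-equality Penrose rigidity
controls the exterior only weakly) · INSTRUMENTABLE (census T-H1–T-H3); ceiling p̄ > 1 EMPTY under
the corrected enclosure Penrose inequ -/
@[route_item "route-FinalStateConjecture-RootDecompScaleTopology", crux]
def HorizonDominatedResidual : Prop :=
  ∀ (X : Type) [TopologicalSpace X] [ChartedSpace Literature.Geometry.Lorentzian.E3 X] [IsManifold (𝓡 3) ((⊤ : ℕ∞) : WithTop ℕ∞) X] [T2Space X] [SecondCountableTopology X] [ConnectedSpace X], let P : Literature.Geometry.Lorentzian.InitialDataSet (𝓡 3) X → Prop := fun D ↦ (∃ 𝒟 : Literature.Geometry.Lorentzian.VacuumCauchyDevelopment D, 𝒟.IsMaximal) ∧ ∀ 𝒟 : Literature.Geometry.Lorentzian.VacuumCauchyDevelopment D, 𝒟.IsMaximal → Summit.FinalStateConjecture.HasCompleteNullInfinity 𝒟.toCauchyDevelopment ∧ ∃ (O : Set 𝒟.carrier) (d : Literature.Geometry.Lorentzian.FinalStateDecomposition 𝒟.toSpacetime O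 2), (∀ i, Literature.Geometry.Lorentzian.Kerr.IsSubextremal (d.mass i) (d.spin i)) ∧ O = Summit.FinalStateConjecture.exteriorOf 𝒟.toCauchyDevelopment d.charted ∧ Summit.FinalStateConjecture.RaysStayInClosure 𝒟.toCauchyDevelopment O ∧ Summit.FinalStateConjecture.HasExhaustiveCharts d ∧ Summit.FinalStateConjecture.IsFutureOriented d; let K : Set (ℝ × ℝ) → Literature.Geometry.Lorentzian.InitialDataSet (𝓡 3) X → Prop := fun W D ↦ ∀ [Literature.Geometry.Lorentzian.Kerr.Facts] [Literature.Geometry.Lorentzian.Kerr.SliceFacts], ∃ (M a r₀ : ℝ) (hM : 0 < M), |a| < M ∧ (|a| / M, r₀ / M) ∈ W ∧ ∃ (θ : Literature.Geometry.Lorentzian.Kerr.slice a r₀ → X) (hθ : ContMDiff 𝓘(ℝ, Literature.Geometry.Lorentzian.E3) (𝓡 3) (((⊤ : ℕ∞) : WithTop ℕ∞) + 1) θ) (hθ' : ∀ u, Injective (mfderiv 𝓘(ℝ, Literature.Geometry.Lorentzian.E3) (𝓡 3) θ u)), Topology.IsOpenEmbedding θ ∧ IsCompact (range θ)ᶜ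 ∧ (∀ s' : ℕ, Literature.Geometry.Lorentzian.InitialDataSet.dataWeightedSobolevEDist s' (-1 : ℝ) (D.comap θ hθ hθ') (Literature.Geometry.Lorentzian.Kerr.data M a r₀ hM.le) < ⊤) ∧ Literature.Geometry.Lorentzian.InitialDataSet.dataWeightedSobolevEDist 6 (-1 : ℝ) (D.comap θ hθ hθ') (Literature.Geometry.Lorentzian.Kerr.data M a r₀ hM.le) < ENNReal.ofReal 1; let Mink : Literature.Geometry.Lorentzian.InitialDataSet (𝓡 3) X → Prop := fun D ↦ ∃ (θ : Literature.Geometry.Lorentzian.Minkowski.slice → X) (hθ : ContMDiff 𝓘(ℝ, Literature.Geometry.Lorentzian.E3) (𝓡 3) (((⊤ : ℕ∞) : WithTop ℕ∞) + 1) θ) (hθ' : ∀ u, Injective (mfderiv 𝓘(ℝ, Literature.Geometry.Lorentzian.E3) (𝓡 3) θ u)), Topology.IsOpenEmbedding θ ∧ Surjective θ ∧ (∀ s' : ℕ, Literature.Geometry.Lorentzian.InitialDataSet.dataWeightedSobolevEDist s' (-1 : ℝ) (D.comap θ hθ hθ') Literature.Geometry.Lorentzian.trivialData < ⊤) ∧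 Literature.Geometry.Lorentzian.InitialDataSet.dataWeightedSobolevEDist 6 (-1 : ℝ) (D.comap θ hθ hθ') Literature.Geometry.Lorentzian.trivialData < ENNReal.ofReal 1; let pert : Set (ℝ × ℝ) := {p | p.1 ≤ (9 / 10 : ℝ) ∧ 1 - Real.sqrt (1 - p.1 ^ 2) < p.2 ∧ p.2 < 1 + Real.sqrt (1 - p.1 ^ 2)}; let collar : Set (ℝ × ℝ) := {p | (9 / 10 : ℝ) < p.1 ∧ 1 - Real.sqrt (1 - p.1 ^ 2) < p.2 ∧ p.2 < 1 + Real.sqrt (1 - p.1 ^ 2)}; let shell : Set (ℝ × ℝ) := {p | 1 + Real.sqrt (1 - p.1 ^ 2) ≤ p.2 ∧ p.2 ≤ 3}; let Hor : Literature.Geometry.Lorentzian.InitialDataSet (𝓡 3) X → Prop := fun D ↦ ∃ (hLC : D.metric.HasLeviCivita) (e : Literature.Geometry.Lorentzian.AFEnd X) (S : Literature.Geometry.Lorentzian.OutermostMOTS (𝓡 3) D.h D.k), haveI : (Literature.Geometry.Lorentzian.PseudoRiemannianMetric.ofRiemannian D.h).HasLeviCivita := hLC; let IsExteriorRegion : TopologicalSpace.Opens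 X → Prop := fun U ↦ IsConnected (U : Set X) ∧ ∃ R', e.R < R' ∧ e.far R' ⊆ (U : Set X) ∧ IsCompact (closure (U : Set X) \ e.far R'); let IsOutsideOf : TopologicalSpace.Opens X → (S' : Type) → (f' : S' → X) → Literature.Geometry.Lorentzian.NormalField (𝓡 3) f' → Prop := fun U _ f' ν' ↦ frontier (U : Set X) = Set.range f' ∧ (∀ y, ∀ᶠ t in nhdsWithin (0 : ℝ) (Set.Ioi 0), Literature.Geometry.Lorentzian.curveThrough (𝓡 3) (f' y) (ν' y) t ∈ (U : Set X)) ∧ (∀ y, ∀ᶠ t in nhdsWithin (0 : ℝ) (Set.Iio 0), Literature.Geometry.Lorentzian.curveThrough (𝓡 3) (f' y) (ν' y) t ∉ closure (U : Set X)) ∧ IsExteriorRegion U; let IsCalS : TopologicalSpace.Opens X → Prop := fun V ↦ ∃ (S' : Type) (_ : TopologicalSpace S') (_ : ChartedSpace (EuclideanSpace ℝ (Fin 2)) S') (_ : IsManifold (𝓡 2) ((⊤ : ℕ∞) : WithTop ℕ∞) S') (_ : CompactSpace S') (_ : T2Space S') (f' : S' → X) (ν' : Literature.Geometry.Lorentzian.NormalField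 (𝓡 3) f'), Manifold.IsSmoothEmbedding (𝓡 2) (𝓡 3) ((⊤ : ℕ∞) : WithTop ℕ∞) f' ∧ (Literature.Geometry.Lorentzian.PseudoRiemannianMetric.ofRiemannian D.h).IsUnitNormal (𝓡 2) f' ν' 1 ∧ IsOutsideOf V S' f' ν'; let WOTFree : TopologicalSpace.Opens X → Prop := fun U ↦ ∀ (S' : Type) [TopologicalSpace S'] [ChartedSpace (EuclideanSpace ℝ (Fin 2)) S'] [IsManifold (𝓡 2) ((⊤ : ℕ∞) : WithTop ℕ∞) S'] [CompactSpace S'] [T2Space S'] (f' : S' → X) (ν' : Literature.Geometry.Lorentzian.NormalField (𝓡 3) f') (hpb' : Literature.Geometry.Lorentzian.PseudoRiemannianMetric.contMDiff_pullbackBilin (𝓡 3) X (𝓡 2) S' ((⊤ : ℕ∞) : WithTop ℕ∞)) (hf' : (Literature.Geometry.Lorentzian.PseudoRiemannianMetric.ofRiemannian D.h).IsSpacelikeImmersion (𝓡 2) f') (Ω : TopologicalSpace.Opens X), Manifold.IsSmoothEmbedding (𝓡 2) (𝓡 3) ((⊤ : ℕ∞) : WithTop ℕ∞) f' → Set.range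 f' ⊆ (U : Set X) → (Literature.Geometry.Lorentzian.PseudoRiemannianMetric.ofRiemannian D.h).IsUnitNormal (𝓡 2) f' ν' 1 → Nonempty S' → frontier (Ω : Set X) = Set.range f' → (∃ R', e.R < R' ∧ Disjoint (e.far R') (Ω : Set X)) → (∀ y, ∀ᶠ t in nhdsWithin (0 : ℝ) (Set.Iio 0), Literature.Geometry.Lorentzian.curveThrough (𝓡 3) (f' y) (ν' y) t ∈ (Ω : Set X)) → ¬ Literature.Geometry.Lorentzian.IsWeaklyOuterTrapped D.h D.k f' hpb' hf' ν'; ContMDiff (𝓡 2) (𝓡 3).tangent ((⊤ : ℕ∞) : WithTop ℕ∞) (fun y ↦ (Bundle.TotalSpace.mk' Literature.Geometry.Lorentzian.E3 (S.f y) (S.ν y) : TangentBundle (𝓡 3) X)) ∧ D.SatisfiesDominantEnergyCondition ∧ e.IsAsymptoticallyFlat D 1 ∧ D.IsComplete ∧ (∃ m, e.HasADMEnergy D m) ∧ (∀ i, ∃ p, e.HasADMMomentum D i p) ∧ WOTFree S.exterior ∧ IsOutsideOf S.exterior S.surf S.f S.ν ∧ 0 < e.admMass D ∧ (letI : MeasurableSpace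 X := borel X; haveI : BorelSpace X := ⟨rfl⟩; haveI : LocallyCompactSpace X := ChartedSpace.locallyCompactSpace Literature.Geometry.Lorentzian.E3 X; (9 / 10 : ℝ) * e.admMass D ≤ Real.sqrt ((⨅ (V : TopologicalSpace.Opens X) (_ : IsCalS V ∧ V ≤ S.exterior), Literature.Geometry.Lorentzian.area D.h (frontier (V : Set X))).toReal / (16 * Real.pi))); ∀ d ∈ Literature.Geometry.Lorentzian.admissibleVacuumData X, ¬ P d → (¬ K pert d ∧ ¬ K collar d ∧ ¬ K shell d ∧ ¬ Mink d) → Hor d → ∃ (e : Literature.Geometry.Lorentzian.AFEnd X) (F : EuclideanSpace ℝ (Fin 1) → Literature.Geometry.Lorentzian.InitialDataSet (𝓡 3) X), Literature.Geometry.Lorentzian.InitialDataSet.IsTameDataFamily e 1 F ∧ Literature.Geometry.Lorentzian.InitialDataSet.IsImmersedAtZero 1 F ∧ F 0 = d ∧ Injective F ∧ (∀ c, F c ∈ Literature.Geometry.Lorentzian.admissibleVacuumData X) ∧ ∀ c ≠ 0, P (F c)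

/-- item stmt-FinalStateConjecture-25089 · crux · rank 5 · open · by planner
why it might fail: no printed basin is uniform as χ → 1 and the extremal limit carries the Aretakis / zero-damped-mode instability; a near-extremal datum could overspin or hover at extremality along every tame curve through it.
sources: arXiv:1707.05862, arXiv:2211.15742, arXiv:1910.02854, Hintz2026, arXiv:1206.6598
[crux] PIECE rung 1a — NearExtremalCapture at (s, δ, β, χ̄, ρ̄, β₀) = (6, −1, 1, 9/10, 3, 1)
[WEAKER·COUNTS — critic CLEARED[regime-fixed] 2026-08-30T01:33:24Z: «WEAKER·IDEA-NEEDED+BARRIER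
(counts)»; leaf IDEA-NEEDED + BARRIER (AretakisInstability prices any uniform-ε approach) +
INSTRUMENTABLE (near-extremal QNM damping ∝ √(1−χ), degeneration rate of ε(χ))]. For every Σ and
every admissible P_Σ-exceptional datum d lying in the near-extremal Kerr window cell — granted the
vendored Kerr facts, some sub-extremal Kerr data (M, a, r₀) with 9/10 < |a|/M < 1 and
horizon-penetrating depth 1 − √(1−χ²) < r₀/M < 1 + √(1−χ²), and a smooth cocompact open embedding θ
of the Kerr slice into Σ along which θ^*d is b-conormal (finite H^s'_(−1) distance at every order)
and 1-close at order 6 to the Kerr data — there are one end e and a tame immersed injective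
one-parameter family F of admissible data with F 0 = d whose members c ≠ 0 satisfy P_Σ. [difficulty:
open-problem] -/
@[route_item "route-FinalStateConjecture-RootDecompScaleTopology", crux]
def NearExtremalCapture : Prop :=
  ∀ (X : Type) [TopologicalSpace X] [ChartedSpace Literature.Geometry.Lorentzian.E3 X] [IsManifold (𝓡 3) ((⊤ : ℕ∞) : WithTop ℕ∞) X] [T2Space X] [SecondCountableTopology X] [ConnectedSpace X], let P : Literature.Geometry.Lorentzian.InitialDataSet (𝓡 3) X → Prop := fun D ↦ (∃ 𝒟 : Literature.Geometry.Lorentzian.VacuumCauchyDevelopment D, 𝒟.IsMaximal) ∧ ∀ 𝒟 : Literature.Geometry.Lorentzian.VacuumCauchyDevelopment D, 𝒟.IsMaximal → Summit.FinalStateConjecture.HasCompleteNullInfinity 𝒟.toCauchyDevelopment ∧ ∃ (O : Set 𝒟.carrier) (d : Literature.Geometry.Lorentzian.FinalStateDecomposition 𝒟.toSpacetime O 2), (∀ i, Literature.Geometry.Lorentzian.Kerr.IsSubextremal (d.mass i) (d.spin i)) ∧ O = Summit.FinalStateConjecture.exteriorOf 𝒟.toCauchyDevelopment d.charted ∧ Summit.FinalStateConjecture.RaysStayInClosure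 𝒟.toCauchyDevelopment O ∧ Summit.FinalStateConjecture.HasExhaustiveCharts d ∧ Summit.FinalStateConjecture.IsFutureOriented d; let K : Set (ℝ × ℝ) → Literature.Geometry.Lorentzian.InitialDataSet (𝓡 3) X → Prop := fun W D ↦ ∀ [Literature.Geometry.Lorentzian.Kerr.Facts] [Literature.Geometry.Lorentzian.Kerr.SliceFacts], ∃ (M a r₀ : ℝ) (hM : 0 < M), |a| < M ∧ (|a| / M, r₀ / M) ∈ W ∧ ∃ (θ : Literature.Geometry.Lorentzian.Kerr.slice a r₀ → X) (hθ : ContMDiff 𝓘(ℝ, Literature.Geometry.Lorentzian.E3) (𝓡 3) (((⊤ : ℕ∞) : WithTop ℕ∞) + 1) θ) (hθ' : ∀ u, Injective (mfderiv 𝓘(ℝ, Literature.Geometry.Lorentzian.E3) (𝓡 3) θ u)), Topology.IsOpenEmbedding θ ∧ IsCompact (range θ)ᶜ ∧ (∀ s' : ℕ, Literature.Geometry.Lorentzian.InitialDataSet.dataWeightedSobolevEDist s' (-1 : ℝ) (D.comap θ hθ hθ') (Literature.Geometry.Lorentzian.Kerr.data M a r₀ hM.le) < ⊤) ∧ Literature.Geometry.Lorentzian.InitialDataSet.dataWeightedSobolevEDist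 6 (-1 : ℝ) (D.comap θ hθ hθ') (Literature.Geometry.Lorentzian.Kerr.data M a r₀ hM.le) < ENNReal.ofReal 1; let collar : Set (ℝ × ℝ) := {p | (9 / 10 : ℝ) < p.1 ∧ 1 - Real.sqrt (1 - p.1 ^ 2) < p.2 ∧ p.2 < 1 + Real.sqrt (1 - p.1 ^ 2)}; ∀ d ∈ Literature.Geometry.Lorentzian.admissibleVacuumData X, ¬ P d → K collar d → ∃ (e : Literature.Geometry.Lorentzian.AFEnd X) (F : EuclideanSpace ℝ (Fin 1) → Literature.Geometry.Lorentzian.InitialDataSet (𝓡 3) X), Literature.Geometry.Lorentzian.InitialDataSet.IsTameDataFamily e 1 F ∧ Literature.Geometry.Lorentzian.InitialDataSet.IsImmersedAtZero 1 F ∧ F 0 = d ∧ Injective F ∧ (∀ c, F c ∈ Literature.Geometry.Lorentzian.admissibleVacuumData X) ∧ ∀ c ≠ 0, P (F c)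

/-- item stmt-FinalStateConjecture-25090 · crux · rank 6 · open · by planner
why it might fail: a strong-field core inside r ≤ 3M (near-critical packet inside its own hoop, pre-merger binary) may form a naked singularity or a non-settling exterior robustly along tame curves — no theorem controls any core below the dressing sphere.
sources: arXiv:2304.08455, arXiv:gr-qc/9402039, arXiv:0805.3880, CorvinoSchoen2006
[crux] PIECE rung 1b — EnclosedCoreCapture at (s, δ, β, χ̄, ρ̄, β₀) = (6, −1, 1, 9/10, 3, 1)
[WEAKER·COUNTS — critic: «WEAKER·IDEA-NEEDED·INSTRUMENTABLE (counts; COSTUME only as ρ̄ → ∞)»; leaf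
INSTRUMENTABLE (close-limit / NR at ρ̄ = 3) + IDEA-NEEDED (large-data mechanism confined to a
compact core: trapped-surface formation inside the hoop, then rung 0)]. For every Σ and every
admissible P_Σ-exceptional datum d lying in the enclosed-core shell cell — sub-extremal Kerr
dressing (b-conormal, 1-close at order 6, weight −1) along a cocompact embedded Kerr slice that
reaches only down to a sphere r₀ = ρM with 1 + √(1−χ²) ≤ ρ ≤ 3 (on or outside the horizon radius;
the core inside is arbitrary) — there are one end e and a tame immersed injective admissible
one-parameter family F with F 0 = d whose members c ≠ 0 satisfy P_Σ. [difficulty: open-problem] -/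
@[route_item "route-FinalStateConjecture-RootDecompScaleTopology", crux]
def EnclosedCoreCapture : Prop :=
  ∀ (X : Type) [TopologicalSpace X] [ChartedSpace Literature.Geometry.Lorentzian.E3 X] [IsManifold (𝓡 3) ((⊤ : ℕ∞) : WithTop ℕ∞) X] [T2Space X] [SecondCountableTopology X] [ConnectedSpace X], let P : Literature.Geometry.Lorentzian.InitialDataSet (𝓡 3) X → Prop := fun D ↦ (∃ 𝒟 : Literature.Geometry.Lorentzian.VacuumCauchyDevelopment D, 𝒟.IsMaximal) ∧ ∀ 𝒟 : Literature.Geometry.Lorentzian.VacuumCauchyDevelopment D, 𝒟.IsMaximal → Summit.FinalStateConjecture.HasCompleteNullInfinity 𝒟.toCauchyDevelopment ∧ ∃ (O : Set 𝒟.carrier) (d : Literature.Geometry.Lorentzian.FinalStateDecomposition 𝒟.toSpacetime O 2), (∀ i, Literature.Geometry.Lorentzian.Kerr.IsSubextremal (d.mass i) (d.spin i)) ∧ O = Summit.FinalStateConjecture.exteriorOf 𝒟.toCauchyDevelopment d.charted ∧ Summit.FinalStateConjecture.RaysStayInClosure 𝒟.toCauchyDevelopment O ∧ Summit.FinalStateConjecture.HasExhaustiveCharts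 d ∧ Summit.FinalStateConjecture.IsFutureOriented d; let K : Set (ℝ × ℝ) → Literature.Geometry.Lorentzian.InitialDataSet (𝓡 3) X → Prop := fun W D ↦ ∀ [Literature.Geometry.Lorentzian.Kerr.Facts] [Literature.Geometry.Lorentzian.Kerr.SliceFacts], ∃ (M a r₀ : ℝ) (hM : 0 < M), |a| < M ∧ (|a| / M, r₀ / M) ∈ W ∧ ∃ (θ : Literature.Geometry.Lorentzian.Kerr.slice a r₀ → X) (hθ : ContMDiff 𝓘(ℝ, Literature.Geometry.Lorentzian.E3) (𝓡 3) (((⊤ : ℕ∞) : WithTop ℕ∞) + 1) θ) (hθ' : ∀ u, Injective (mfderiv 𝓘(ℝ, Literature.Geometry.Lorentzian.E3) (𝓡 3) θ u)), Topology.IsOpenEmbedding θ ∧ IsCompact (range θ)ᶜ ∧ (∀ s' : ℕ, Literature.Geometry.Lorentzian.InitialDataSet.dataWeightedSobolevEDist s' (-1 : ℝ) (D.comap θ hθ hθ') (Literature.Geometry.Lorentzian.Kerr.data M a r₀ hM.le) < ⊤) ∧ Literature.Geometry.Lorentzian.InitialDataSet.dataWeightedSobolevEDist 6 (-1 : ℝ)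 (D.comap θ hθ hθ') (Literature.Geometry.Lorentzian.Kerr.data M a r₀ hM.le) < ENNReal.ofReal 1; let shell : Set (ℝ × ℝ) := {p | 1 + Real.sqrt (1 - p.1 ^ 2) ≤ p.2 ∧ p.2 ≤ 3}; ∀ d ∈ Literature.Geometry.Lorentzian.admissibleVacuumData X, ¬ P d → K shell d → ∃ (e : Literature.Geometry.Lorentzian.AFEnd X) (F : EuclideanSpace ℝ (Fin 1) → Literature.Geometry.Lorentzian.InitialDataSet (𝓡 3) X), Literature.Geometry.Lorentzian.InitialDataSet.IsTameDataFamily e 1 F ∧ Literature.Geometry.Lorentzian.InitialDataSet.IsImmersedAtZero 1 F ∧ F 0 = d ∧ Injective F ∧ (∀ c, F c ∈ Literature.Geometry.Lorentzian.admissibleVacuumData X) ∧ ∀ c ≠ 0, P (F c)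

/-- item stmt-FinalStateConjecture-25092 · crux · rank 7 · open · by planner
why it might fail: β = 1 is an absolute radius while every printed basin ε(M, χ) is inexplicit and non-uniform; data 1-close to a small-mass Kerr anchor are relatively large perturbations and may collapse further or radiate away the hole.
sources: KlainermanSzeftel2023, arXiv:2205.14808, Hintz2026, arXiv:2104.08222
[crux] PIECE rung 0→1 — PerturbativeCapture at (s, δ, β, χ̄, ρ̄, β₀) = (6, −1, 1, 9/10, 3, 1)
[WEAKER; critic: «DECORATIVE-by-claim (β → 0⁺) / UNDECIDED[effective ε], ATTACKABLE (porting) — NOT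
COUNTED»; at the typed β = 1 OPEN only by effectivity of the printed ε(M, χ) and scale
non-covariance (lens H2); leaf ATTACKABLE (porting
`klainerman_szeftel_kerr_stability_small_a_cauchy`, `hintz_kerr_stability_subextremal_cauchy`
through the lens's `onCell_of_forall_settles`) + IDEA-NEEDED (effective basin radius)]. For every Σ
and every admissible P_Σ-exceptional datum d in the perturbative Kerr window cell (spin ratio ≤
9/10, horizon-penetrating depth, b-conormal and 1-close at order 6, weight −1, to sub-extremal Kerr
data along a cocompact embedded Kerr slice), there are one end e and a tame immersed injective
admissible one-parameter family F with F 0 = d whose members c ≠ 0 satisfy P_Σ. [difficulty: XL] -/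
@[route_item "route-FinalStateConjecture-RootDecompScaleTopology", crux]
def PerturbativeCapture : Prop :=
  ∀ (X : Type) [TopologicalSpace X] [ChartedSpace Literature.Geometry.Lorentzian.E3 X] [IsManifold (𝓡 3) ((⊤ : ℕ∞) : WithTop ℕ∞) X] [T2Space X] [SecondCountableTopology X] [ConnectedSpace X], let P : Literature.Geometry.Lorentzian.InitialDataSet (𝓡 3) X → Prop := fun D ↦ (∃ 𝒟 : Literature.Geometry.Lorentzian.VacuumCauchyDevelopment D, 𝒟.IsMaximal) ∧ ∀ 𝒟 : Literature.Geometry.Lorentzian.VacuumCauchyDevelopment D, 𝒟.IsMaximal → Summit.FinalStateConjecture.HasCompleteNullInfinity 𝒟.toCauchyDevelopment ∧ ∃ (O : Set 𝒟.carrier) (d : Literature.Geometry.Lorentzian.FinalStateDecomposition 𝒟.toSpacetime O 2), (∀ i, Literature.Geometry.Lorentzian.Kerr.IsSubextremal (d.mass i) (d.spin i)) ∧ O = Summit.FinalStateConjecture.exteriorOf 𝒟.toCauchyDevelopment d.charted ∧ Summit.FinalStateConjecture.RaysStayInClosure 𝒟.toCauchyDevelopment O ∧ Summit.FinalStateConjecture.HasExhaustiveCharts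 d ∧ Summit.FinalStateConjecture.IsFutureOriented d; let K : Set (ℝ × ℝ) → Literature.Geometry.Lorentzian.InitialDataSet (𝓡 3) X → Prop := fun W D ↦ ∀ [Literature.Geometry.Lorentzian.Kerr.Facts] [Literature.Geometry.Lorentzian.Kerr.SliceFacts], ∃ (M a r₀ : ℝ) (hM : 0 < M), |a| < M ∧ (|a| / M, r₀ / M) ∈ W ∧ ∃ (θ : Literature.Geometry.Lorentzian.Kerr.slice a r₀ → X) (hθ : ContMDiff 𝓘(ℝ, Literature.Geometry.Lorentzian.E3) (𝓡 3) (((⊤ : ℕ∞) : WithTop ℕ∞) + 1) θ) (hθ' : ∀ u, Injective (mfderiv 𝓘(ℝ, Literature.Geometry.Lorentzian.E3) (𝓡 3) θ u)), Topology.IsOpenEmbedding θ ∧ IsCompact (range θ)ᶜ ∧ (∀ s' : ℕ, Literature.Geometry.Lorentzian.InitialDataSet.dataWeightedSobolevEDist s' (-1 : ℝ) (D.comap θ hθ hθ') (Literature.Geometry.Lorentzian.Kerr.data M a r₀ hM.le) < ⊤) ∧ Literature.Geometry.Lorentzian.InitialDataSet.dataWeightedSobolevEDist 6 (-1 : ℝ)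 (D.comap θ hθ hθ') (Literature.Geometry.Lorentzian.Kerr.data M a r₀ hM.le) < ENNReal.ofReal 1; let pert : Set (ℝ × ℝ) := {p | p.1 ≤ (9 / 10 : ℝ) ∧ 1 - Real.sqrt (1 - p.1 ^ 2) < p.2 ∧ p.2 < 1 + Real.sqrt (1 - p.1 ^ 2)}; ∀ d ∈ Literature.Geometry.Lorentzian.admissibleVacuumData X, ¬ P d → K pert d → ∃ (e : Literature.Geometry.Lorentzian.AFEnd X) (F : EuclideanSpace ℝ (Fin 1) → Literature.Geometry.Lorentzian.InitialDataSet (𝓡 3) X), Literature.Geometry.Lorentzian.InitialDataSet.IsTameDataFamily e 1 F ∧ Literature.Geometry.Lorentzian.InitialDataSet.IsImmersedAtZero 1 F ∧ F 0 = d ∧ Injective F ∧ (∀ c, F c ∈ Literature.Geometry.Lorentzian.admissibleVacuumData X) ∧ ∀ c ≠ 0, P (F c)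

/-- item stmt-FinalStateConjecture-25093 · crux · rank 8 · open · by planner
why it might fail: no explicit Christodoulou–Klainerman radius is in print; β₀ = 1 in H^6_(−1) may exceed the true dispersive basin, letting some cell data collapse to a black hole whose settling is then the full problem.
sources: ChristodoulouKlainerman1993, arXiv:2108.13379, LindbladRodnianski2010, Bieri2009
[crux] PIECE rung 0′ — SmallDataDispersal at (s, δ, β, χ̄, ρ̄, β₀) = (6, −1, 1, 9/10, 3, 1) [WEAKER;
critic: «same (CK93) — NOT COUNTED»; DECORATIVE in the limit β₀ → 0⁺ by
`christodoulou_klainerman_stability_minkowski_cauchy`; at β₀ = 1 open by effectivity only; leaf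
ATTACKABLE (porting of gr.S07-cauchy) + effective part IDEA-NEEDED]. For every Σ and every
admissible P_Σ-exceptional datum d in the Minkowski cell (Σ globally a copy of ℝ³ via a surjective
smooth open embedding θ of the Minkowski slice, θ^*d b-conormal and 1-close at order 6, weight −1,
to the trivial data), there are one end e and a tame immersed injective admissible one-parameter
family F with F 0 = d whose members c ≠ 0 satisfy P_Σ. [difficulty: XL] -/
@[route_item "route-FinalStateConjecture-RootDecompScaleTopology", crux]
def SmallDataDispersal : Prop :=
  ∀ (X : Type) [TopologicalSpace X] [ChartedSpace Literature.Geometry.Lorentzian.E3 X] [IsManifold (𝓡 3) ((⊤ : ℕ∞) : WithTop ℕ∞) X] [T2Space X] [SecondCountableTopology X] [ConnectedSpace X], let P : Literature.Geometry.Lorentzian.InitialDataSet (𝓡 3) X → Prop := fun D ↦ (∃ 𝒟 : Literature.Geometry.Lorentzian.VacuumCauchyDevelopment D, 𝒟.IsMaximal) ∧ ∀ 𝒟 : Literature.Geometry.Lorentzian.VacuumCauchyDevelopment D, 𝒟.IsMaximal → Summit.FinalStateConjecture.HasCompleteNullInfinity 𝒟.toCauchyDevelopment ∧ ∃ (O :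 Set 𝒟.carrier) (d : Literature.Geometry.Lorentzian.FinalStateDecomposition 𝒟.toSpacetime O 2), (∀ i, Literature.Geometry.Lorentzian.Kerr.IsSubextremal (d.mass i) (d.spin i)) ∧ O = Summit.FinalStateConjecture.exteriorOf 𝒟.toCauchyDevelopment d.charted ∧ Summit.FinalStateConjecture.RaysStayInClosure 𝒟.toCauchyDevelopment O ∧ Summit.FinalStateConjecture.HasExhaustiveCharts d ∧ Summit.FinalStateConjecture.IsFutureOriented d; let Mink : Literature.Geometry.Lorentzian.InitialDataSet (𝓡 3) X → Prop := fun D ↦ ∃ (θ : Literature.Geometry.Lorentzian.Minkowski.slice → X) (hθ : ContMDiff 𝓘(ℝ, Literature.Geometry.Lorentzian.E3) (𝓡 3) (((⊤ : ℕ∞) : WithTop ℕ∞) + 1) θ) (hθ' : ∀ u, Injective (mfderiv 𝓘(ℝ, Literature.Geometry.Lorentzian.E3) (𝓡 3) θ u)), Topology.IsOpenEmbedding θ ∧ Surjective θ ∧ (∀ s' : ℕ, Literature.Geometry.Lorentzian.InitialDataSet.dataWeightedSobolevEDist s' (-1 : ℝ) (D.comap θ hθ hθ') Literature.Geometry.Lorentzian.trivialData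 < ⊤) ∧ Literature.Geometry.Lorentzian.InitialDataSet.dataWeightedSobolevEDist 6 (-1 : ℝ) (D.comap θ hθ hθ') Literature.Geometry.Lorentzian.trivialData < ENNReal.ofReal 1; ∀ d ∈ Literature.Geometry.Lorentzian.admissibleVacuumData X, ¬ P d → Mink d → ∃ (e : Literature.Geometry.Lorentzian.AFEnd X) (F : EuclideanSpace ℝ (Fin 1) → Literature.Geometry.Lorentzian.InitialDataSet (𝓡 3) X), Literature.Geometry.Lorentzian.InitialDataSet.IsTameDataFamily e 1 F ∧ Literature.Geometry.Lorentzian.InitialDataSet.IsImmersedAtZero 1 F ∧ F 0 = d ∧ Injective F ∧ (∀ c, F c ∈ Literature.Geometry.Lorentzian.admissibleVacuumData X) ∧ ∀ c ≠ 0, P (F c)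

/-- item stmt-FinalStateConjecture-28284 · assembly · rank 1 · open · by planner
sources: arXiv:1204.0278
[assembly] PerturbativeCapture → NearExtremalCapture → EnclosedCoreCapture → SmallDataDispersal →
HorizonDominatedResidual → SubdominantHorizonResidual → HorizonFreeResidual → the final state
conjecture as typed. -/
@[route_item "route-FinalStateConjecture-RootDecompScaleTopology"]
def Assembly : Prop :=
  PerturbativeCapture → NearExtremalCapture → EnclosedCoreCapture → SmallDataDispersal → HorizonDominatedResidual → SubdominantHorizonResidual → HorizonFreeResidual → FinalStateConjecture

/-! D-0027 §2.1 — DECIDING THEOREM (planner-authored via `route open/edit --closes-file`; by planner-decomp-fsc-writer-1-g0-0 2026-08-30T05:03:55Z):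
its hypotheses are this route's items and its conclusion the sub-problem Statement (glue_lint), and it elaborates with this file. -/

@[closes "route-FinalStateConjecture-RootDecompScaleTopology"] theorem closes (h₀ : PerturbativeCapture) (h₁ : NearExtremalCapture) (h₂ : EnclosedCoreCapture)
    (h₃ : SmallDataDispersal) (hA : HorizonDominatedResidual) (hB₁ : SubdominantHorizonResidual)
    (hB₂ : HorizonFreeResidual) : _root_.FinalStateConjecture := by
  intro X _ _ _ _ _ _ d hd
  suffices h : ∃ (e : Literature.Geometry.Lorentzian.AFEnd X) (F : EuclideanSpace ℝ (Fin 1) → Literature.Geometry.Lorentzian.InitialDataSet (𝓡 3) X), Literature.Geometry.Lorentzian.InitialDataSet.IsTameDataFamily e 1 F ∧ Literature.Geometry.Lorentzian.InitialDataSet.IsImmersedAtZero 1 F ∧ F 0 = d ∧ Injective F ∧ (∀ c, F c ∈ Literature.Geometry.Lorentzian.admissibleVacuumData X) ∧ ∀ c ≠ 0, ((∃ 𝒟 : Literature.Geometry.Lorentzian.VacuumCauchyDevelopment (F c), 𝒟.IsMaximal) ∧ ∀ 𝒟 : Literature.Geometry.Lorentzian.VacuumCauchyDevelopment (F c), 𝒟.IsMaximal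 → Summit.FinalStateConjecture.HasCompleteNullInfinity 𝒟.toCauchyDevelopment ∧ ∃ (O : Set 𝒟.carrier) (d : Literature.Geometry.Lorentzian.FinalStateDecomposition 𝒟.toSpacetime O 2), (∀ i, Literature.Geometry.Lorentzian.Kerr.IsSubextremal (d.mass i) (d.spin i)) ∧ O = Summit.FinalStateConjecture.exteriorOf 𝒟.toCauchyDevelopment d.charted ∧ Summit.FinalStateConjecture.RaysStayInClosure 𝒟.toCauchyDevelopment O ∧ Summit.FinalStateConjecture.HasExhaustiveCharts d ∧ Summit.FinalStateConjecture.IsFutureOriented d) by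
    obtain ⟨e, F, h1, h2, h3, h4, h5, h6⟩ := h
    exact ⟨e, F, h1, h2, h3, h4, h5, fun c hc hmem ↦ hmem.2 (h6 c hc)⟩
  by_cases c₀ : ∀ [Literature.Geometry.Lorentzian.Kerr.Facts] [Literature.Geometry.Lorentzian.Kerr.SliceFacts], ∃ (M a r₀ : ℝ) (hM : 0 < M), |a| < M ∧ (|a| / M, r₀ / M) ∈ {p | p.1 ≤ (9 / 10 : ℝ) ∧ 1 - Real.sqrt (1 - p.1 ^ 2) < p.2 ∧ p.2 < 1 + Real.sqrt (1 - p.1 ^ 2)} ∧ ∃ (θ : Literature.Geometry.Lorentzian.Kerr.slice a r₀ → X) (hθ : ContMDiff 𝓘(ℝ, Literature.Geometry.Lorentzian.E3) (𝓡 3) (((⊤ : ℕ∞) : WithTop ℕ∞) + 1) θ) (hθ' : ∀ u, Injective (mfderiv 𝓘(ℝ, Literature.Geometry.Lorentzian.E3) (𝓡 3) θ u)), Topology.IsOpenEmbedding θ ∧ IsCompact (range θ)ᶜ ∧ (∀ s' : ℕ, Literature.Geometry.Lorentzian.InitialDataSet.dataWeightedSobolevEDist s' (-1 : ℝ) (d.comap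 θ hθ hθ') (Literature.Geometry.Lorentzian.Kerr.data M a r₀ hM.le) < ⊤) ∧ Literature.Geometry.Lorentzian.InitialDataSet.dataWeightedSobolevEDist 6 (-1 : ℝ) (d.comap θ hθ hθ') (Literature.Geometry.Lorentzian.Kerr.data M a r₀ hM.le) < ENNReal.ofReal 1
  · exact h₀ X d hd.1 hd.2 c₀
  by_cases c₁ : ∀ [Literature.Geometry.Lorentzian.Kerr.Facts] [Literature.Geometry.Lorentzian.Kerr.SliceFacts], ∃ (M a r₀ : ℝ) (hM : 0 < M), |a| < M ∧ (|a| / M, r₀ / M) ∈ {p | (9 / 10 : ℝ) < p.1 ∧ 1 - Real.sqrt (1 - p.1 ^ 2) < p.2 ∧ p.2 < 1 + Real.sqrt (1 - p.1 ^ 2)} ∧ ∃ (θ : Literature.Geometry.Lorentzian.Kerr.slice a r₀ → X) (hθ : ContMDiff 𝓘(ℝ, Literature.Geometry.Lorentzian.E3) (𝓡 3) (((⊤ : ℕ∞) : WithTop ℕ∞) + 1) θ) (hθ' : ∀ u, Injective (mfderiv 𝓘(ℝ, Literature.Geometry.Lorentzian.E3) (𝓡 3) θ u)), Topology.IsOpenEmbedding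 θ ∧ IsCompact (range θ)ᶜ ∧ (∀ s' : ℕ, Literature.Geometry.Lorentzian.InitialDataSet.dataWeightedSobolevEDist s' (-1 : ℝ) (d.comap θ hθ hθ') (Literature.Geometry.Lorentzian.Kerr.data M a r₀ hM.le) < ⊤) ∧ Literature.Geometry.Lorentzian.InitialDataSet.dataWeightedSobolevEDist 6 (-1 : ℝ) (d.comap θ hθ hθ') (Literature.Geometry.Lorentzian.Kerr.data M a r₀ hM.le) < ENNReal.ofReal 1
  · exact h₁ X d hd.1 hd.2 c₁
  by_cases c₂ : ∀ [Literature.Geometry.Lorentzian.Kerr.Facts] [Literature.Geometry.Lorentzian.Kerr.SliceFacts], ∃ (M a r₀ : ℝ) (hM : 0 < M), |a| < M ∧ (|a| / M, r₀ / M) ∈ {p | 1 + Real.sqrt (1 - p.1 ^ 2) ≤ p.2 ∧ p.2 ≤ 3} ∧ ∃ (θ : Literature.Geometry.Lorentzian.Kerr.slice a r₀ → X) (hθ : ContMDiff 𝓘(ℝ, Literature.Geometry.Lorentzian.E3) (𝓡 3) (((⊤ : ℕ∞) : WithTop ℕ∞) + 1) θ) (hθ' : ∀ u, Injective (mfderiv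 𝓘(ℝ, Literature.Geometry.Lorentzian.E3) (𝓡 3) θ u)), Topology.IsOpenEmbedding θ ∧ IsCompact (range θ)ᶜ ∧ (∀ s' : ℕ, Literature.Geometry.Lorentzian.InitialDataSet.dataWeightedSobolevEDist s' (-1 : ℝ) (d.comap θ hθ hθ') (Literature.Geometry.Lorentzian.Kerr.data M a r₀ hM.le) < ⊤) ∧ Literature.Geometry.Lorentzian.InitialDataSet.dataWeightedSobolevEDist 6 (-1 : ℝ) (d.comap θ hθ hθ') (Literature.Geometry.Lorentzian.Kerr.data M a r₀ hM.le) < ENNReal.ofReal 1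
  · exact h₂ X d hd.1 hd.2 c₂
  by_cases c₃ : ∃ (θ : Literature.Geometry.Lorentzian.Minkowski.slice → X) (hθ : ContMDiff 𝓘(ℝ, Literature.Geometry.Lorentzian.E3) (𝓡 3) (((⊤ : ℕ∞) : WithTop ℕ∞) + 1) θ) (hθ' : ∀ u, Injective (mfderiv 𝓘(ℝ, Literature.Geometry.Lorentzian.E3) (𝓡 3) θ u)), Topology.IsOpenEmbedding θ ∧ Surjective θ ∧ (∀ s' : ℕ, Literature.Geometry.Lorentzian.InitialDataSet.dataWeightedSobolevEDist s' (-1 : ℝ) (d.comap θ hθ hθ') Literature.Geometry.Lorentzian.trivialData < ⊤) ∧ Literature.Geometry.Lorentzian.InitialDataSet.dataWeightedSobolevEDist 6 (-1 : ℝ) (d.comap θ hθ hθ') Literature.Geometry.Lorentzian.trivialData < ENNReal.ofReal 1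
  · exact h₃ X d hd.1 hd.2 c₃
  -- the extended-field residual (stmt-25091) rebuilt from 26560 «Hor d», 27211 «AH d, ¬ Hor d» and 27212 «¬ AH d»
  -- by two excluded middles (on the horizon guard «Hor d», then on the apparent-horizon guard «AH d»)
  exact (Classical.em _).elim (fun hH ↦ hA X d hd.1 hd.2 ⟨c₀, c₁, c₂, c₃⟩ hH)
    (fun hH ↦ (Classical.em _).elim (fun hAH ↦ hB₁ X d hd.1 hd.2 ⟨c₀, c₁, c₂, c₃⟩ hAH hH)
      (fun hAH ↦ hB₂ X d hd.1 hd.2 ⟨c₀, c₁, c₂, c₃⟩ hAH))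

end Summit.FinalStateConjecture.FinalStateConjecture.Theses.RootDecompScaleTopology
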